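import Mathlib
import Literature.NumberTheory.LFunctions.Zhang2022.SkeletonPartThree
import Literature.Analysis.Complex.PerronHigherOrder
import Literature.NumberTheory.LFunctions.Zhang2022.SkeletonAlpha1
import HarnessLib

/-!
# Zhang (2022), typed manuscript — Appendix B "Some arithmetic sums": the proofs of Lemma 15.1
# and Lemma 17.1, every displayed step as a named `Prop` (D-0069 campaign, layer L4, slice t10)

Topic `Literature/NumberTheory/LFunctions/Zhang2022` (Landau–Siegel audit tree; verdict-neutral).
Y. Zhang, *Discrete mean estimates and the Landau–Siegel zero*, arXiv:2211.02515v1 (2022)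
[Zhang2022LandauSiegel] — **an unrefereed manuscript under adjudication. Every `def … : Prop` below
is a CLAIM OF THE MANUSCRIPT, STATED NOT ASSERTED; nothing here asserts or denies its Theorems 1–2.**
Source slice: Appendix B, PDF pp. 106–109, `lsz3__2_.tex` lines 5248–5378 (DAG nodes
`Z22:Lem15.1.pf`, `Z22:§B.u001`–`Z22:§B.u024`, `Z22:(B.1)`–`Z22:(B.3)`, `Z22:Lem17.1.pf` of the cell's
`plan/DAG.tsv`; `Z22:§B.u025` (tex L5509) is a TeX-macro artefact, not a display).

What Appendix B does. (1) *Proof of Lemma 15.1* (`Skeleton.Lemma151`): with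
`ϱ_j(n) = Σ_{d∣n} μ(d)d^{β_j}` (`varrhoJ`) it replaces `χ(n)ϱ*_j(n)` on `(n,𝔮) = 1` by `ϱ_j(n)`
((B.1), (B.2)), and evaluates `Σ_l ϰ_μ(l₁l)ϱ_j(l)/l` for `μ = 2, 3, 1` by a Perron integral and the
residues at `s = 0` and `s = β₇` (resp. `β₆`) — these residue sums ARE Lemma 15.1's printed constants
`e_{2j}, e_{3j}, e′_{1j}` (tree: `appB_main_e2j`, `appB_main_e3j`, `appB_main_e1pj`, `circleIntegral_appB`
in `Zhang2022/AppendixB.lean`, kernel-checked at the main values) — and the truncation tail (B.3), whose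
printed right side is Lemma 15.1's `e″_{1j}` (`e1ppj`) while the LAST display of its proof is, at the
main values, the tree's `e1ppD j = −jπi·b*` (`appB3_main`, `e1ppD_eq`), a different number
(`Section18EpsilonIdentity`); both sides are typed here as printed (`EqB_3`, `StepB_u015b`, `StepB_u015c`).
(2) *Proof of Lemma 17.1* (`Skeleton.AppBLemma171`, a THEOREM of the tree, `Skeleton.appBLemma171_holds`
/ `Lemma171.lemma_17_1`): smoothing by `g(T/n)` "by Lemma 3.1", Mellin, the Euler product of
`Σ ν(n)²n^{−s}` (three cases, "[19, (1.2.10)]" = Titchmarsh; tree `tsum_divisorSumChar_sq_prime_pow`,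
`LSeries_divisorSumChar_sq_of_sq_eq_one`), and the residue at `s = 0`.

Conventions (plan/L4/ASSIGNMENTS.md §1, skel/INTERFACE.md §3). Objects are the banked skeleton's:
`𝓛 = Skeleton.ell D`, `P = Skeleton.bigP D`, `α = Skeleton.alpha D`, `T = Skeleton.bigT D`,
`P₁, P₂, P₃ = Skeleton.P1/P2/P3 D`, `β_j = Skeleton.betaJ c' D j` (`c′` of (2.13)), `β₆, β₇ = Skeleton.beta6/7 D`,
`ϰ₁, ϰ₂, ϰ₃ = Skeleton.vk1/vk2/vk3 D`, `ν = Skeleton.nu χ`, `𝔮 = Skeleton.frakq D`, `ϱ*_j = Skeleton.varrhoStar`,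
`𝔫(·) = Skeleton.nset`, `g = Skeleton.gW D` ((4.1)), `ω₁ = GaussWeight.omega1 (𝓛³⁰)`, `𝔞 = Skeleton.frakA χ`,
`τ₂(n) = n.divisors.card`. Shapes: "`X ≪ Y`" ↦ `∃ C, ForAllLarge (… ≤ C·Y)`; "`X = Y + O(α₁)`" ↦
`∃ C, ForAllLarge (‖X − Y‖ ≤ C·α·𝓛)`; "`o(1)`" ↦ `∀ ε > 0, ForAllLarge (… ≤ ε)`; Assumption (A) is an
antecedent of every asymptotic claim that involves `χ` (Lemma 15.1 and Lemma 17.1 live under (A)); the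
asymptotic claims about `χ`-free quantities (`ϱ_j`, `ϰ_μ`, `ζ`, `g`: (B.2), (B.3) and the evaluations
after (B.2)) are typed unconditionally, so that they can be proved or refuted as statements of analysis;
exact identities valid for every modulus are plain `∀`. `(1/2πi)∫_{(c)} F(s) ds` is `vline c F := (1/2π)∫_ℝ F(c+it) dt`.

READINGS (flagged, not repaired): (i) `α₁` is undefined in v1 — the decls of the first three sections
read `α₁ := α𝓛` as in the banked `Skeleton.Lemma151`/`Skeleton.Lemma121`; the skeleton owner has since
RULED the reading of record `α₁ := α·log T = α𝓛^{1.1}` (`Skeleton.alpha1`, file `SkeletonAlpha1`,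
`Skeleton.Lemma151ChiR`), and the final section `ReadingR` re-types the eleven `O(α₁)` claims with
`C·alpha1 D` (suffix `R`; the `α𝓛` decls stay as typed — they are the stronger claims, other files import
them — and imply the `R` forms, `…R_of`); e.g. `log P₂ = 0.5 log P − 10𝓛^{1.1}` makes `Z22:§B.u010` false
under `α𝓛` and true under `α₁ = α log T` (`resZero2_sub_main_eq`, `stepB_u010bR_holds`); (ii) the parameter `l₁` of the displays after (B.2)
is never introduced in print — read as a divisor of the `n₁` of Lemma 15.1 (`n₁ ∈ 𝔫(𝔮)`, `n₁ < T`), so the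
claims are typed for `l₁ ∈ 𝔫(𝔮)`, `1 ≤ l₁ < T`; (iii) "the sum of the residues of the integrand at
`s = 0` and `s = β₇`" is typed as `(2πi)⁻¹∮_{|s|=5α}` (the circle encloses exactly these two
singularities; the tree's `circleIntegral_appB` convention), single residues as `(2πi)⁻¹∮` over circles of
radius `α`; "an acceptable error" / the bare "`+O`" of tex L5331 are read `O(α₁)`; (iv) (B.3) prints
`l > P^{12}/l₁` — read `P^{1/2}` (the cut of `ϰ₁` in `b(n)`, (15.1)); (v) dangling "in a way similar to the
proof of," (tex L5329) and "the integral (14)" (tex L5368, = the integral of `StepB_u017`) are noted;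
(vi) the three-term chains of the Euler-factor displays are typed as conjunctions of their equalities;
(vii) from tex L5282 on the displays carry `ϱ*_j(l)` WITHOUT the factor `χ(l)` of Lemma 15.1's summand
`b(n₁n)χ(n)ϱ*_j(n)/n` — typed as printed.

Kernel-checked here: `stepB_u022_holds` (the display is the tree's `LSeries_divisorSumChar_sq_of_sq_eq_one`),
`lem17_1_pf_holds` (Lemma 17.1 is `Skeleton.appBLemma171_holds`), and — section `Discharges` at the end —
the identity leaves `stepB_u004h_holds` (`h > D⁴`), `stepB_u005a_holds` (`ϱ_j(qʳ) = ϱ_j(q) = 1 − q^{β_j}`,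
`|ϱ_j(q)| ≤ Cα log q`), `stepB_u007_holds` (`Σ ϱ_j(l)l^{−s} = ζ(s)/ζ(s−β_j)`), `stepB_u008_holds` (Perron's
formula for `ϰ₂`, via the tree's `Literature.Analysis.Complex.integral_perronPow_vertical`),
`stepB_u018_holds`–`stepB_u021_holds` (the Euler product of `Σ ν²n^{−s}` and its three local cases, via the
tree's `hasSum_geomPartialSum_sq_mul_pow`) and `stepB_u024b_holds` (`L′(1,χ)²∏_p(1−p⁻²)∏_{p∣D}(1−p⁻¹)(1−p⁻²)⁻¹
= 𝔞`, via Mathlib's Euler product for `ζ(2) = π²/6` and the tree's `Lemma171.frakAC_eq`); then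
`stepB_u017_holds` (the Mellin form of `Σ ν²/n·g(T/n)`, the tree's `GaussWeight.integral_LSeries_mul_kernel`),
`stepB_u014_holds` (the change of variable `w = s − β₆` in (4.1)'s Mellin form of `g`) and
`stepB_u009_holds` (the `μ = 2` display: `StepB_u007` at `1+s`, Perron termwise, `Σ_l`/`∫` interchanged by
absolute convergence, `D ≥ 8` so that `P₂ > 1`); and in section `ReadingR` the exact `D`-dependence of the
left side of `Z22:§B.u010` (`resZero2_sub_main_eq`: `−β_j/(β₇² log P₂) − (−8j/(25πi)) =
i(8j/25π)(κ_jc′α𝓛 + δ)/(1 − δ)`, `δ = (20/π)α𝓛^{1.1}`) with `stepB_u010bR_holds` (the display HOLDS with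
error `≤ (48/25π)(5|c′| + 20/π)·α₁`, `D ≥ 8`). The last section `ReadingU005` records the faithful
two-constant reading `StepB_u005₂` of `Z22:§B.u005` (gap row G-d59-2; proved in
`AppendixBVarrhoU005`, which bridges to it).

## References

* Y. Zhang, arXiv:2211.02515v1 (2022), Appendix B pp. 106–109; §15 Lemma 15.1 p. 86; §17 Lemma 17.1
  p. 97; (4.1)–(4.3) p. 20. [cite: Zhang2022LandauSiegel, App. B]
* E. C. Titchmarsh, *The Theory of the Riemann Zeta-Function*, 2nd ed. (1986), (1.2.10) (the source's
  "[19, (1.2.10)]"; consumed via the tree's `RamanujanDivisorSquare`). [cite: Titchmarsh1986, (1.2.10)]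
-/

noncomputable section

open Complex Real MeasureTheory
open scoped LSeries.notation

namespace Literature.NumberTheory.LFunctions.Zhang2022.Typed.AppendixB

/-! ## Helper: vertical-line integrals -/

/-- `(1/2πi)∫_{(c)} F(s) ds`, the integral up the vertical line `Re s = c` (the source's notation, §4
p. 20, "`g(x) = (1/2πi)∫_{(c)} x^w ω₁(w) dw/w`"), as the real integral `(1/2π)∫_ℝ F(c + it) dt` (the
convention of the tree's `GaussWeight.gWeight_eq_verticalIntegral`). Plumbing definition.
[cite: Zhang2022LandauSiegel, §4 p.20] -/
def vline (c : ℝ) (F : ℂ → ℂ) : ℂ := (1 / (2 * Real.pi) : ℂ) * ∫ t : ℝ, F ((c : ℂ) + (t : ℂ) * I)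

/-! ## Proof of Lemma 15.1 (pp. 106–108): the objects -/

section LemmaFifteenOneObjects

variable (c' : ℝ) (D : ℕ)

/-- **`ϱ_j(n) = Σ_{d∣n} μ(d)d^{β_j}`** ("Proof of Lemma 15.1. Put …"; a NEW object, not the `ϱ*_j` of
(15.21) = `Skeleton.varrhoStar`, which carries `χ(d)` in place of `μ(d)`). DAG `Z22:§B.u001`
[Z22 p.106, tex L5249]. [cite: Zhang2022LandauSiegel, App. B proof of Lemma 15.1, p.106] -/
def varrhoJ (j n : ℕ) : ℂ :=
  ∑ d ∈ n.divisors, (ArithmeticFunction.moebius d : ℂ) * (d : ℂ) ^ Skeleton.betaJ c' D j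

/-- `ζ(1+s)/ζ(1+s−β_j)`, the Dirichlet series `Σ_l ϱ_j(l)l^{−1−s}` of the integrands of Appendix B
(`StepB_u007`). [cite: Zhang2022LandauSiegel, App. B p.107] -/
def zetaRatio (j : ℕ) (s : ℂ) : ℂ :=
  riemannZeta (1 + s) / riemannZeta (1 + s - Skeleton.betaJ c' D j)

/-- The Perron kernel `(P_μ/m)ˢ/((log P_μ)(s − β)²)` of the displays for `ϰ₂` (with `P₂, β₇`) and, "with
`β₆` and `P₃` in place of `β₇` and `P₂`", for `ϰ₃`; for `ϰ₁` with `P₁, β₆`.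
[cite: Zhang2022LandauSiegel, App. B p.107] -/
def kerB (Pμ : ℝ) (β : ℂ) (m : ℕ) (s : ℂ) : ℂ :=
  ((Pμ / m : ℝ) : ℂ) ^ s / ((Real.log Pμ : ℂ) * (s - β) ^ 2)

/-- The integrand of the `μ = 2` display: `ζ(1+s)/ζ(1+s−β_j) · (P₂/l₁)ˢ/((log P₂)(s − β₇)²)`.
[cite: Zhang2022LandauSiegel, App. B p.107] -/
def intB2 (j l₁ : ℕ) (s : ℂ) : ℂ :=
  zetaRatio c' D j s * kerB (Skeleton.P2 D) (Skeleton.beta7 D) l₁ s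

/-- The printed value of "the residue at `s = 0`": `−β_j/(β₇² log P₂)` (DAG `Z22:§B.u010`).
[cite: Zhang2022LandauSiegel, App. B p.107] -/
def resZero2 (j : ℕ) : ℂ :=
  -Skeleton.betaJ c' D j / (Skeleton.beta7 D ^ 2 * (Real.log (Skeleton.P2 D) : ℂ))

/-- The printed expression for "the residue at `s = β₇` …, by the Cauchy integral formula":
`ζ(1+β₇)/ζ(1+β₇−β_j) · (log(P₂/l₁)/log P₂)(P₂/l₁)^{β₇} + (1/log P₂)(P₂/l₁)^{β₇} d/ds[ζ(1+s)/ζ(1+s−β_j)]|_{s=β₇}`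
(DAG `Z22:§B.u011`, first line). [cite: Zhang2022LandauSiegel, App. B p.107] -/
def resBeta2 (j l₁ : ℕ) : ℂ :=
  zetaRatio c' D j (Skeleton.beta7 D) *
      ((Real.log (Skeleton.P2 D / l₁) / Real.log (Skeleton.P2 D) : ℝ) : ℂ) *
      ((Skeleton.P2 D / l₁ : ℝ) : ℂ) ^ Skeleton.beta7 D +
    (1 / Real.log (Skeleton.P2 D) : ℝ) * ((Skeleton.P2 D / l₁ : ℝ) : ℂ) ^ Skeleton.beta7 D *
      deriv (zetaRatio c' D j) (Skeleton.beta7 D)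

/-- The `ϰ_μ`-weighted sum `Σ_l ϰ_μ(l₁l)ϱ_j(l)/l` (the `l`-sum is finite: `ϰ_μ(l₁l) = 0` once `l₁l ≥ P_μ`,
and `P_μ < P`; taken over `1 ≤ l < P`). [cite: Zhang2022LandauSiegel, App. B p.107] -/
def vkSum (vk : ℕ → ℂ) (j l₁ : ℕ) : ℂ :=
  ∑ l ∈ Finset.Ico 1 ⌈Skeleton.bigP D⌉₊, vk (l₁ * l) * varrhoJ c' D j l / (l : ℂ)

/-- The left side of (B.3): `Σ_{l > P^{1/2}/l₁} ϰ₁(l₁l)ϱ_j(l)/l` (printed `P^{12}`, read `P^{1/2}` — the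
cut `n < P^{1/2}` of `ϰ₁` in `b(n)`, (15.1)). [cite: Zhang2022LandauSiegel, App. B (B.3), p.108] -/
def tailB3 (j l₁ : ℕ) : ℂ :=
  ∑ l ∈ (Finset.Ico 1 ⌈Skeleton.bigP D⌉₊).filter
      (fun l : ℕ => Skeleton.bigP D ^ (1 / 2 : ℝ) / l₁ < (l : ℝ)),
    Skeleton.vk1 D (l₁ * l) * varrhoJ c' D j l / (l : ℂ)

/-- The series of the display "By (4.2) and (4.3), the left side of (B.3) is equal to":
`Σ_l ϱ_j(l)/l · (P₁/(l₁l))^{β₆} · (1/0.504)∫_{0.5}^{0.504} {g(P^z/(l₁l)) − g(P^{0.5}/(l₁l))} dz`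
(DAG `Z22:§B.u013`). [cite: Zhang2022LandauSiegel, App. B p.108] -/
def seriesB13 (j l₁ : ℕ) : ℂ :=
  ∑' l : ℕ, varrhoJ c' D j l / (l : ℂ) * ((Skeleton.P1 D / (l₁ * l : ℕ) : ℝ) : ℂ) ^ Skeleton.beta6 D *
    (((1 / 0.504 : ℝ) : ℂ) * ∫ z in (0.5 : ℝ)..0.504,
      ((Skeleton.gW D (Skeleton.bigP D ^ z / (l₁ * l : ℕ)) -
        Skeleton.gW D (Skeleton.bigP D ^ (0.5 : ℝ) / (l₁ * l : ℕ)) : ℝ) : ℂ))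

/-- The Mellin factor `P^{β₆(0.504−z)}P^{zs} − P^{0.004β₆}P^{0.5s}` of the displays after (B.3).
[cite: Zhang2022LandauSiegel, App. B p.108] -/
def mellinB14 (z : ℝ) (s : ℂ) : ℂ :=
  (Skeleton.bigP D : ℂ) ^ (Skeleton.beta6 D * ((0.504 - z : ℝ) : ℂ)) *
      (Skeleton.bigP D : ℂ) ^ ((z : ℂ) * s) -
    (Skeleton.bigP D : ℂ) ^ (((0.004 : ℝ) : ℂ) * Skeleton.beta6 D) *
      (Skeleton.bigP D : ℂ) ^ (((0.5 : ℝ) : ℂ) * s)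

/-- The double integral of the last display of the proof of (B.3), first line:
`(1/0.504)∫_{0.5}^{0.504} {(1/2πi)∫_{(1)} (P^{β₆(0.504−z)}P^{zs} − P^{0.004β₆}P^{0.5s}) ζ(1+s)/ζ(1+s−β_j)
ω₁(s−β₆)/(l₁ˢ(s−β₆)) ds} dz` (DAG `Z22:§B.u015`). [cite: Zhang2022LandauSiegel, App. B p.108] -/
def doubleB15 (j l₁ : ℕ) : ℂ :=
  ((1 / 0.504 : ℝ) : ℂ) * ∫ z in (0.5 : ℝ)..0.504,
    vline 1 (fun s => mellinB14 D z s * zetaRatio c' D j s *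
      GaussWeight.omega1 (Skeleton.ell D ^ 30) (s - Skeleton.beta6 D) /
        ((l₁ : ℂ) ^ s * (s - Skeleton.beta6 D)))

/-- The value the proof of (B.3) arrives at (last display, second line):
`(1/0.504)(β_j/β₆)∫_{0.5}^{0.504} (P^{β₆(0.504−z)} − P^{0.004β₆}) dz` — at the main values the tree's
`e1ppD j` (`AppendixB.appB3_main`; `e1ppD_eq`: `= −jπi·b*`). [cite: Zhang2022LandauSiegel, App. B p.108] -/
def valueB15 (j : ℕ) : ℂ :=
  ((1 / 0.504 : ℝ) : ℂ) * (Skeleton.betaJ c' D j / Skeleton.beta6 D) *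
    ∫ z in (0.5 : ℝ)..0.504,
      ((Skeleton.bigP D : ℂ) ^ (Skeleton.beta6 D * ((0.504 - z : ℝ) : ℂ)) -
        (Skeleton.bigP D : ℂ) ^ (((0.004 : ℝ) : ℂ) * Skeleton.beta6 D))

end LemmaFifteenOneObjects

/-! ## Proof of Lemma 15.1: the claims (B.1), (B.2) and the steps between -/

section LemmaFifteenOneClaims

variable (c' : ℝ)

/-- **(B.1)**: "`Σ_{n<P, (n,𝔮)=1} |ϱ_j(n) − ϱ*_j(n)|/n ≪ 𝓛⁻⁸`" (`1 ≤ j ≤ 3`; proved "together with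
Lemma 3.2", hence under (A)). CLAIM; refines `Skeleton.Lemma151` (first reduction of its proof).
DAG `Z22:(B.1)` [Z22 p.106, (B.1), tex L5253]. [cite: Zhang2022LandauSiegel, App. B (B.1), p.106] -/
def EqB_1 : Prop :=
  ∃ C : ℝ, Skeleton.ForAllLarge fun D _ χ => Skeleton.AssumptionA D χ →
    ∀ j ∈ ({1, 2, 3} : Finset ℕ),
      ∑ n ∈ (Finset.Ico 1 ⌈Skeleton.bigP D⌉₊).filter (fun n => Nat.Coprime n (Skeleton.frakq D)),
          ‖varrhoJ c' D j n - Skeleton.varrhoStar c' χ j n‖ / (n : ℝ) ≤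
        C / Skeleton.ell D ^ 8

/-- "Since `χ = μ∗ν`, it follows that `χ(d) = μ(d) + O(Σ_{h∣d, h>1} ν(h))`" (pointwise in `d`, absolute
constant; `ν = 1∗χ` so `μ∗ν = χ`). CLAIM. DAG `Z22:§B.u002` [Z22 p.106, tex L5257].
[cite: Zhang2022LandauSiegel, App. B p.106] -/
def StepB_u002 : Prop :=
  ∃ C : ℝ, ∀ (D : ℕ) [NeZero D] (χ : DirichletCharacter ℂ D), ∀ d : ℕ, 1 ≤ d →
    ‖χ (d : ZMod D) - (ArithmeticFunction.moebius d : ℂ)‖ ≤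
      C * ∑ h ∈ d.divisors.filter (fun h => 1 < h), ‖Skeleton.nu χ h‖

/-- "Hence `ϱ_j(n) − ϱ*_j(n) ≪ Σ_{h∣n, h>1} ν(h)τ₂(n/h)`" (pointwise in `n`; `|d^{β_j}| = 1` as `β_j` is
purely imaginary). CLAIM. DAG `Z22:§B.u003` [Z22 p.106, tex L5261]. [cite: Zhang2022LandauSiegel, App. B p.106] -/
def StepB_u003 : Prop :=
  ∃ C : ℝ, ∀ (D : ℕ) [NeZero D] (χ : DirichletCharacter ℂ D), ∀ j ∈ ({1, 2, 3} : Finset ℕ),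
    ∀ n : ℕ, 1 ≤ n →
      ‖varrhoJ c' D j n - Skeleton.varrhoStar c' χ j n‖ ≤
        C * ∑ h ∈ n.divisors.filter (fun h => 1 < h), ‖Skeleton.nu χ h‖ * ((n / h).divisors.card : ℝ)

/-- "If `h > 1` and `(h,𝔮) = 1`, then `h > D⁴`" (`𝔮 = ∏_{q<D⁴} q`; the lead-in of the next display).
CLAIM. DAG `Z22:§B.u004` (lead-in) [Z22 p.106, tex L5264]. [cite: Zhang2022LandauSiegel, App. B p.106] -/
def StepB_u004h : Prop :=
  ∀ D h : ℕ, 1 < h → Nat.Coprime h (Skeleton.frakq D) → D ^ 4 < h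

/-- "Hence, by substituting `n = hm`,
`Σ_{n<P,(n,𝔮)=1} |ϱ_j(n) − ϱ*_j(n)|/n ≪ Σ_{h>D⁴} ν(h)/h · Σ_{m<P/h} τ₂(m)/m ≪ (log P)² Σ_{D⁴<h<P} ν(h)/h`"
(typed as the two inequalities of the chain, one implied constant; `h < P` since `hm < P`). CLAIM.
DAG `Z22:§B.u004` [Z22 p.106, tex L5265]. [cite: Zhang2022LandauSiegel, App. B p.106] -/
def StepB_u004 : Prop :=
  ∃ C : ℝ, Skeleton.ForAllLarge fun D _ χ => Skeleton.AssumptionA D χ →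
    ∀ j ∈ ({1, 2, 3} : Finset ℕ),
      (∑ n ∈ (Finset.Ico 1 ⌈Skeleton.bigP D⌉₊).filter (fun n => Nat.Coprime n (Skeleton.frakq D)),
            ‖varrhoJ c' D j n - Skeleton.varrhoStar c' χ j n‖ / (n : ℝ) ≤
          C * ∑ h ∈ Finset.Ioo (D ^ 4) ⌈Skeleton.bigP D⌉₊, ‖Skeleton.nu χ h‖ / h *
            ∑ m ∈ Finset.Ico 1 ⌈Skeleton.bigP D / h⌉₊, ((m.divisors.card : ℝ) / m)) ∧
      (∑ h ∈ Finset.Ioo (D ^ 4) ⌈Skeleton.bigP D⌉₊, ‖Skeleton.nu χ h‖ / h *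
            ∑ m ∈ Finset.Ico 1 ⌈Skeleton.bigP D / h⌉₊, ((m.divisors.card : ℝ) / m) ≤
          C * Real.log (Skeleton.bigP D) ^ 2 *
            ∑ h ∈ Finset.Ioo (D ^ 4) ⌈Skeleton.bigP D⌉₊, ‖Skeleton.nu χ h‖ / h)

/-- **(B.2)**: "`Σ_{n<P, (n,𝔮)>1} |ϱ_j(n)|/n ≪ 𝓛⁻⁸`". CLAIM; refines `Skeleton.Lemma151`.
DAG `Z22:(B.2)` [Z22 p.106, (B.2), tex L5271]. [cite: Zhang2022LandauSiegel, App. B (B.2), p.106] -/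
def EqB_2 : Prop :=
  ∃ C : ℝ, Skeleton.ForAllLarge fun D _ _ =>
    ∀ j ∈ ({1, 2, 3} : Finset ℕ),
      ∑ n ∈ (Finset.Ico 1 ⌈Skeleton.bigP D⌉₊).filter (fun n => ¬ Nat.Coprime n (Skeleton.frakq D)),
          ‖varrhoJ c' D j n‖ / (n : ℝ) ≤
        C / Skeleton.ell D ^ 8

/-- "Note that `ϱ_j(qʳ) = ϱ_j(q)` for any `r`, and `ϱ_j(q) ≪ α log q` if `q < P`" (`q` prime, `r ≥ 1`;
the lead-in of the next display). CLAIM. DAG `Z22:§B.u005` (lead-in) [Z22 p.107, tex L5274].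
[cite: Zhang2022LandauSiegel, App. B p.107] -/
def StepB_u005a : Prop :=
  (∀ (D : ℕ), ∀ j ∈ ({1, 2, 3} : Finset ℕ), ∀ q r : ℕ, q.Prime → 1 ≤ r →
      varrhoJ c' D j (q ^ r) = varrhoJ c' D j q) ∧
    ∃ C : ℝ, Skeleton.ForAllLarge fun D _ _ => ∀ j ∈ ({1, 2, 3} : Finset ℕ), ∀ q : ℕ, q.Prime →
      (q : ℝ) < Skeleton.bigP D → ‖varrhoJ c' D j q‖ ≤ C * Skeleton.alpha D * Real.log q

/-- "Thus the left side above [of (B.2)] is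
`≤ (Σ_{q<D⁴} |ϱ_j(q)|/q) ∏_{q<P} (1 + |ϱ_j(q)|/q + O(1/q²)) ≪ α Σ_{q<D⁴} log q/q`" (`q` prime; the
`O(1/q²)` inside the product typed with one uniform constant; the two relations of the chain). CLAIM.
DAG `Z22:§B.u005` [Z22 p.107, tex L5275]. [cite: Zhang2022LandauSiegel, App. B p.107] -/
def StepB_u005 : Prop :=
  ∃ C : ℝ, Skeleton.ForAllLarge fun D _ _ =>
    ∀ j ∈ ({1, 2, 3} : Finset ℕ),
      (∑ n ∈ (Finset.Ico 1 ⌈Skeleton.bigP D⌉₊).filter (fun n => ¬ Nat.Coprime n (Skeleton.frakq D)),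
            ‖varrhoJ c' D j n‖ / (n : ℝ) ≤
          (∑ q ∈ (Finset.range (D ^ 4)).filter Nat.Prime, ‖varrhoJ c' D j q‖ / q) *
            ∏ q ∈ (Finset.range ⌈Skeleton.bigP D⌉₊).filter Nat.Prime,
              (1 + ‖varrhoJ c' D j q‖ / q + C / (q : ℝ) ^ 2)) ∧
      ((∑ q ∈ (Finset.range (D ^ 4)).filter Nat.Prime, ‖varrhoJ c' D j q‖ / q) *
            ∏ q ∈ (Finset.range ⌈Skeleton.bigP D⌉₊).filter Nat.Prime,
              (1 + ‖varrhoJ c' D j q‖ / q + C / (q : ℝ) ^ 2) ≤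
          C * Skeleton.alpha D * ∑ q ∈ (Finset.range (D ^ 4)).filter Nat.Prime, Real.log q / q)

/-- "By (B.1) and (B.2), for `μ = 2, 3`,
`Σ_{(l,𝔮)=1} ϰ_μ(l₁l)ϱ*_j(l)/l = Σ_l ϰ_μ(l₁l)ϱ_j(l)/l + O(𝓛⁻⁸)`" (`ϰ₂, ϰ₃ = Skeleton.vk2/vk3`; `l₁` as in the
module docstring, reading (ii); FLAG (vii): the left side carries `ϱ*_j(l)`, not the `χ(l)ϱ*_j(l)` of
Lemma 15.1's summand — typed as printed). CLAIM. DAG `Z22:§B.u006` [Z22 p.107, tex L5282].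
[cite: Zhang2022LandauSiegel, App. B p.107] -/
def StepB_u006 : Prop :=
  ∃ C : ℝ, Skeleton.ForAllLarge fun D _ χ => Skeleton.AssumptionA D χ →
    ∀ j ∈ ({1, 2, 3} : Finset ℕ), ∀ l₁ : ℕ, 1 ≤ l₁ → l₁ ∈ Skeleton.nset (Skeleton.frakq D) →
      (l₁ : ℝ) < Skeleton.bigT D → ∀ vk ∈ ({Skeleton.vk2 D, Skeleton.vk3 D} : Set (ℕ → ℂ)),
        ‖(∑ l ∈ (Finset.Ico 1 ⌈Skeleton.bigP D⌉₊).filter (fun l => Nat.Coprime l (Skeleton.frakq D)),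
              vk (l₁ * l) * Skeleton.varrhoStar c' χ j l / (l : ℂ)) -
            vkSum c' D vk j l₁‖ ≤
          C / Skeleton.ell D ^ 8

/-- "`Σ_l ϱ_j(l)/lˢ = ζ(s)/ζ(s − β_j)` for `σ > 1`" (an identity for every modulus: `β_j` is purely
imaginary, so `Re(s − β_j) = σ`). CLAIM. DAG `Z22:§B.u007` [Z22 p.107, tex L5288].
[cite: Zhang2022LandauSiegel, App. B p.107] -/
def StepB_u007 : Prop :=
  ∀ (D : ℕ), ∀ j ∈ ({1, 2, 3} : Finset ℕ), ∀ s : ℂ, 1 < s.re →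
    LSeries (fun l => varrhoJ c' D j l) s = riemannZeta s / riemannZeta (s - Skeleton.betaJ c' D j)

/-- "`ϰ₂(m) = (1/2πi)∫_{(1)} (P₂/m)ˢ/((log P₂)(s − β₇)²) ds`" (Perron's formula for the weight (8.6),
`Skeleton.vk2`; cf. the tree's `AppendixB.circleIntegral_appB` for the residue form). CLAIM (an identity,
typed for `P₂ > 1`, `m ≥ 1`). DAG `Z22:§B.u008` [Z22 p.107, tex L5292]. [cite: Zhang2022LandauSiegel, App. B p.107] -/
def StepB_u008 : Prop :=
  ∀ D : ℕ, 1 < Skeleton.P2 D → ∀ m : ℕ, 1 ≤ m →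
    Skeleton.vk2 D m = vline 1 (kerB (Skeleton.P2 D) (Skeleton.beta7 D) m)

/-- "it follows that `Σ_l ϰ₂(l₁l)ϱ_j(l)/l = (1/2πi)∫_{(1)} ζ(1+s)/ζ(1+s−β_j) · (P₂/l₁)ˢ/((log P₂)(s−β₇)²) ds`".
CLAIM. DAG `Z22:§B.u009` [Z22 p.107, tex L5296]. [cite: Zhang2022LandauSiegel, App. B p.107] -/
def StepB_u009 : Prop :=
  Skeleton.ForAllLarge fun D _ _ => ∀ j ∈ ({1, 2, 3} : Finset ℕ), ∀ l₁ : ℕ, 1 ≤ l₁ →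
    vkSum c' D (Skeleton.vk2 D) j l₁ = vline 1 (intB2 c' D j l₁)

/-- "In a way similar to the proof of Lemma 8.1, we see that the right side is equal to the sum of the
residues of the integrand at `s = 0` and `s = β₇` plus an acceptable error" (the residue sum typed as
`(2πi)⁻¹∮_{|s| = 5α}`, reading (iii); "acceptable error" read `O(α₁) = O(α𝓛)`; a method reference to
`Skeleton.Lemma81`, not a use of its statement). CLAIM. DAG `Z22:§B.u009` (text after the display)
[Z22 p.107, tex L5298]. [cite: Zhang2022LandauSiegel, App. B p.107] -/
def StepB_u009r : Prop :=
  ∃ C : ℝ, Skeleton.ForAllLarge fun D _ _ =>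
    ∀ j ∈ ({1, 2, 3} : Finset ℕ), ∀ l₁ : ℕ, 1 ≤ l₁ → l₁ ∈ Skeleton.nset (Skeleton.frakq D) →
      (l₁ : ℝ) < Skeleton.bigT D →
        ‖vline 1 (intB2 c' D j l₁) -
            (2 * π * I)⁻¹ * (∮ s in C((0 : ℂ), 5 * Skeleton.alpha D), intB2 c' D j l₁ s)‖ ≤
          C * Skeleton.alpha D * Skeleton.ell D

/-- "By direct calculation, the residue at `s = 0` is `−β_j/(β₇² log P₂)`" — AS PRINTED (the residue
typed as `(2πi)⁻¹∮_{|s| = α}`, reading (iii)). FLAG: `ζ(1+s)/ζ(1+s−β_j)` has a simple pole at `0` with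
residue `1/ζ(1 − β_j)`, so the exact residue of the integrand is `(ζ(1−β_j))⁻¹/(β₇² log P₂)`; the print
uses the polar main part `−β_j` of `1/ζ(1−β_j)` (the two agree to `O(α)`; the tree's `AppendixB.lean`
uses the same main-part convention). CLAIM. DAG `Z22:§B.u010` (first equality) [Z22 p.107, tex L5300].
[cite: Zhang2022LandauSiegel, App. B p.107] -/
def StepB_u010a : Prop :=
  Skeleton.ForAllLarge fun D _ _ => ∀ j ∈ ({1, 2, 3} : Finset ℕ), ∀ l₁ : ℕ, 1 ≤ l₁ →
    (2 * π * I)⁻¹ * (∮ s in C((0 : ℂ), Skeleton.alpha D), intB2 c' D j l₁ s) = resZero2 c' D j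

/-- "`−β_j/(β₇² log P₂) = −8j/(25πi) + O(α₁)`" (at the main values `β_j⁰ = jiα`, `log P₂ ↦ 0.5 log P`,
`α log P = π` this is exact: tree `AppendixB.appBResZero_main_mu2`). CLAIM. DAG `Z22:§B.u010`
(second equality) [Z22 p.107, tex L5300]. [cite: Zhang2022LandauSiegel, App. B p.107] -/
def StepB_u010b : Prop :=
  ∃ C : ℝ, Skeleton.ForAllLarge fun D _ _ => ∀ j ∈ ({1, 2, 3} : Finset ℕ),
    ‖resZero2 c' D j - (-(8 * (j : ℂ) / (25 * π * I)))‖ ≤ C * Skeleton.alpha D * Skeleton.ell D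

/-- "the residue at `s = β₇` is, by the Cauchy integral formula,
`ζ(1+β₇)/ζ(1+β₇−β_j) · (log(P₂/l₁)/log P₂)(P₂/l₁)^{β₇} + (1/log P₂)(P₂/l₁)^{β₇} d/ds[ζ(1+s)/ζ(1+s−β_j)]|_{s=β₇}`"
(the residue at the double pole typed as `(2πi)⁻¹∮_{|s−β₇| = α}`, reading (iii); the right side is
`resBeta2`). CLAIM. DAG `Z22:§B.u011` (first line) [Z22 p.107, tex L5304]. [cite: Zhang2022LandauSiegel, App. B p.107] -/
def StepB_u011a : Prop :=
  Skeleton.ForAllLarge fun D _ _ => ∀ j ∈ ({1, 2, 3} : Finset ℕ), ∀ l₁ : ℕ, 1 ≤ l₁ →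
    (2 * π * I)⁻¹ * (∮ s in C(Skeleton.beta7 D, Skeleton.alpha D), intB2 c' D j l₁ s) =
      resBeta2 c' D j l₁

/-- "`… = (1 − 2j/5 + 8j/(25πi)) exp{5πi/4} + O(α₁)`" (the residue at `β₇` evaluated; exact at the main
values with `l₁ = 1`: tree `AppendixB.appBResBeta_main_mu2`). CLAIM. DAG `Z22:§B.u011` (second line)
[Z22 p.107, tex L5308]. [cite: Zhang2022LandauSiegel, App. B p.107] -/
def StepB_u011b : Prop :=
  ∃ C : ℝ, Skeleton.ForAllLarge fun D _ _ =>
    ∀ j ∈ ({1, 2, 3} : Finset ℕ), ∀ l₁ : ℕ, 1 ≤ l₁ → l₁ ∈ Skeleton.nset (Skeleton.frakq D) →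
      (l₁ : ℝ) < Skeleton.bigT D →
        ‖resBeta2 c' D j l₁ -
            (1 - 2 * (j : ℂ) / 5 + 8 * (j : ℂ) / (25 * π * I)) * cexp (5 * π * I / 4)‖ ≤
          C * Skeleton.alpha D * Skeleton.ell D

/-- "These together complete the proof in case `μ = 2`": the `μ = 2` assertion
`Σ_l ϰ₂(l₁l)ϱ_j(l)/l = e_{2j} + O(α₁)` (`e_{2j}` = `Section18Defs.e2j`, Lemma 15.1; the residue sum at the
main values is exactly `e2j j`: tree `AppendixB.appB_main_e2j`). CLAIM (implicit in print).
DAG `Z22:§B.u011` (closing sentence) [Z22 p.107, tex L5309]. [cite: Zhang2022LandauSiegel, App. B p.107] -/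
def StepB_mu2 : Prop :=
  ∃ C : ℝ, Skeleton.ForAllLarge fun D _ _ =>
    ∀ j ∈ ({1, 2, 3} : Finset ℕ), ∀ l₁ : ℕ, 1 ≤ l₁ → l₁ ∈ Skeleton.nset (Skeleton.frakq D) →
      (l₁ : ℝ) < Skeleton.bigT D →
        ‖vkSum c' D (Skeleton.vk2 D) j l₁ - e2j j‖ ≤ C * Skeleton.alpha D * Skeleton.ell D

/-- "In case `μ = 3` the proof can be obtained with `β₆` and `P₃` in place of `β₇` and `P₂` respectively":
`Σ_l ϰ₃(l₁l)ϱ_j(l)/l = e_{3j} + O(α₁)` (`e_{3j}` = `Section18Defs.e3j`; tree `AppendixB.appB_main_e3j`).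
CLAIM (implicit in print). DAG `Z22:§B.u011` (text) [Z22 p.107, tex L5310]. [cite: Zhang2022LandauSiegel, App. B p.107] -/
def StepB_mu3 : Prop :=
  ∃ C : ℝ, Skeleton.ForAllLarge fun D _ _ =>
    ∀ j ∈ ({1, 2, 3} : Finset ℕ), ∀ l₁ : ℕ, 1 ≤ l₁ → l₁ ∈ Skeleton.nset (Skeleton.frakq D) →
      (l₁ : ℝ) < Skeleton.bigT D →
        ‖vkSum c' D (Skeleton.vk3 D) j l₁ - e3j j‖ ≤ C * Skeleton.alpha D * Skeleton.ell D

/-- "The same argument also gives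
`Σ_l ϰ₁(l₁l)ϱ_j(l)/l = (1 − 2j/3 + j/(1.134πi)) exp{0.756πi} − j/(1.134πi) + O(α₁)`" (the right side is
Lemma 15.1's `e′_{1j}` = `Section18Defs.e1pj` verbatim; tree `AppendixB.appB_main_e1pj`). CLAIM.
DAG `Z22:§B.u012` [Z22 p.107, tex L5311]. [cite: Zhang2022LandauSiegel, App. B p.107] -/
def StepB_u012 : Prop :=
  ∃ C : ℝ, Skeleton.ForAllLarge fun D _ _ =>
    ∀ j ∈ ({1, 2, 3} : Finset ℕ), ∀ l₁ : ℕ, 1 ≤ l₁ → l₁ ∈ Skeleton.nset (Skeleton.frakq D) →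
      (l₁ : ℝ) < Skeleton.bigT D →
        ‖vkSum c' D (Skeleton.vk1 D) j l₁ - e1pj j‖ ≤ C * Skeleton.alpha D * Skeleton.ell D

/-- **(B.3)**: "For `μ = 1` the proof is therefore reduced to showing that
`Σ_{l > P^{1/2}/l₁} ϰ₁(l₁l)ϱ_j(l)/l = (j/0.756)∫₀^{0.004} (exp{(3/2)(0.504−z)πi} − exp{(3/4)πi}) dz + O(α₁)`"
(printed `P^{12}`, reading (iv); the right side is Lemma 15.1's printed `e″_{1j}` = `Section18Defs.e1ppj`
verbatim). CLAIM. DAG `Z22:(B.3)` [Z22 p.108, (B.3), tex L5316]. [cite: Zhang2022LandauSiegel, App. B (B.3), p.108] -/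
def EqB_3 : Prop :=
  ∃ C : ℝ, Skeleton.ForAllLarge fun D _ _ =>
    ∀ j ∈ ({1, 2, 3} : Finset ℕ), ∀ l₁ : ℕ, 1 ≤ l₁ → l₁ ∈ Skeleton.nset (Skeleton.frakq D) →
      (l₁ : ℝ) < Skeleton.bigT D →
        ‖tailB3 c' D j l₁ - e1ppj j‖ ≤ C * Skeleton.alpha D * Skeleton.ell D

/-- "By (4.2) and (4.3), the left side of (B.3) is equal to
`Σ_l ϱ_j(l)/l (P₁/(l₁l))^{β₆} (1/0.504)∫_{0.5}^{0.504} {g(P^z/(l₁l)) − g(P^{0.5}/(l₁l))} dz + O(α₁)`"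
((4.2), (4.3) are theorems of the tree: `GaussWeight.abs_gWeight_sub_one_le`, `GaussWeight.gWeight_le`).
CLAIM. DAG `Z22:§B.u013` [Z22 p.108, tex L5322]. [cite: Zhang2022LandauSiegel, App. B p.108] -/
def StepB_u013 : Prop :=
  ∃ C : ℝ, Skeleton.ForAllLarge fun D _ _ =>
    ∀ j ∈ ({1, 2, 3} : Finset ℕ), ∀ l₁ : ℕ, 1 ≤ l₁ → l₁ ∈ Skeleton.nset (Skeleton.frakq D) →
      (l₁ : ℝ) < Skeleton.bigT D →
        ‖tailB3 c' D j l₁ - seriesB13 c' D j l₁‖ ≤ C * Skeleton.alpha D * Skeleton.ell D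

/-- "By a change of variable, for `0.5 ≤ z ≤ 0.504`,
`(P₁/y)^{β₆} {g(P^z/y) − g(P^{0.5}/y)} = (1/2πi)∫_{(1)} (P^{β₆(0.504−z)}P^{zs} − P^{0.004β₆}P^{0.5s}) ω₁(s−β₆) ds/(yˢ(s−β₆))`"
(`g` of (4.1) = `Skeleton.gW`, its Mellin form is the tree's `GaussWeight.gWeight_eq_verticalIntegral`;
`P₁ = P^{0.504}`, `w = s − β₆`). CLAIM (an identity for every large modulus, `y > 0`).
DAG `Z22:§B.u014` [Z22 p.108, tex L5326]. [cite: Zhang2022LandauSiegel, App. B p.108] -/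
def StepB_u014 : Prop :=
  Skeleton.ForAllLarge fun D _ _ => ∀ y : ℝ, 0 < y → ∀ z ∈ Set.Icc (0.5 : ℝ) 0.504,
    ((Skeleton.P1 D / y : ℝ) : ℂ) ^ Skeleton.beta6 D *
        ((Skeleton.gW D (Skeleton.bigP D ^ z / y) - Skeleton.gW D (Skeleton.bigP D ^ (0.5 : ℝ) / y) : ℝ) : ℂ) =
      vline 1 (fun s => mellinB14 D z s * GaussWeight.omega1 (Skeleton.ell D ^ 30) (s - Skeleton.beta6 D) /
        ((y : ℂ) ^ s * (s - Skeleton.beta6 D)))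

/-- "Hence, in a way similar to the proof of, we find that the left side of (B.3) is
`(1/0.504)∫_{0.5}^{0.504} {(1/2πi)∫_{(1)} (P^{β₆(0.504−z)}P^{zs} − P^{0.004β₆}P^{0.5s}) ζ(1+s)/ζ(1+s−β_j)
ω₁(s−β₆) ds/(l₁ˢ(s−β₆))} dz + O`" — FLAGS: the reference after "proof of" is missing in print (tex L5329)
and the error term is a bare "`+O`" (tex L5331), read `O(α₁)` (reading (iii)). CLAIM.
DAG `Z22:§B.u015` (first line) [Z22 p.108, tex L5330]. [cite: Zhang2022LandauSiegel, App. B p.108] -/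
def StepB_u015a : Prop :=
  ∃ C : ℝ, Skeleton.ForAllLarge fun D _ _ =>
    ∀ j ∈ ({1, 2, 3} : Finset ℕ), ∀ l₁ : ℕ, 1 ≤ l₁ → l₁ ∈ Skeleton.nset (Skeleton.frakq D) →
      (l₁ : ℝ) < Skeleton.bigT D →
        ‖tailB3 c' D j l₁ - doubleB15 c' D j l₁‖ ≤ C * Skeleton.alpha D * Skeleton.ell D

/-- "`= (1/0.504)(β_j/β₆)∫_{0.5}^{0.504} (P^{β₆(0.504−z)} − P^{0.004β₆}) dz + O(α₁)`" (the residue at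
`s = 0` of the inner integrand; at the main values the value is the tree's `e1ppD j`, `AppendixB.appB3_main`).
CLAIM. DAG `Z22:§B.u015` (second line) [Z22 p.108, tex L5333]. [cite: Zhang2022LandauSiegel, App. B p.108] -/
def StepB_u015b : Prop :=
  ∃ C : ℝ, Skeleton.ForAllLarge fun D _ _ =>
    ∀ j ∈ ({1, 2, 3} : Finset ℕ), ∀ l₁ : ℕ, 1 ≤ l₁ → l₁ ∈ Skeleton.nset (Skeleton.frakq D) →
      (l₁ : ℝ) < Skeleton.bigT D →
        ‖doubleB15 c' D j l₁ - valueB15 c' D j‖ ≤ C * Skeleton.alpha D * Skeleton.ell D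

/-- The closing "□" of the proof of (B.3): the derived value equals the printed right side of (B.3),
`(1/0.504)(β_j/β₆)∫_{0.5}^{0.504}(P^{β₆(0.504−z)} − P^{0.004β₆})dz = e″_{1j} + O(α₁)` (`e″_{1j}` AS STATED in
Lemma 15.1, `Section18Defs.e1ppj`). FLAG (tree, kernel-checked, no adjudication implied here): at the main
values the left side is `e1ppD j = −jπi·b*` (`AppendixB.appB3_main_eq_bstar`), and
`Section18EpsilonIdentity` certifies `e1ppD 1 ≠ e1ppj 1` (`|e″₁₁(printed) − e″₁₁(derived)| > 3.8·10⁻⁵`);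
both readings of `e″_{1j}` are carried by the tree (`e1ppj`, `e1ppD`). CLAIM (implicit in print).
DAG `Z22:§B.u015` ("□") [Z22 p.108, tex L5334]. [cite: Zhang2022LandauSiegel, App. B p.108] -/
def StepB_u015c : Prop :=
  ∃ C : ℝ, Skeleton.ForAllLarge fun D _ _ =>
    ∀ j ∈ ({1, 2, 3} : Finset ℕ),
      ‖valueB15 c' D j - e1ppj j‖ ≤ C * Skeleton.alpha D * Skeleton.ell D

/-- **The proof block of Lemma 15.1** (Appendix B, pp. 106–108) as ONE named implication from its cited
external input: "This together with Lemma 3.2 yields (B.1)" — Lemma 3.2 (`Skeleton.Lemma32`) ⇒ Lemma 15.1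
(`Skeleton.Lemma151`), through the internal chain `EqB_1`, `EqB_2`, `StepB_u006`–`StepB_u015c`; the other
cited inputs are theorems of the tree ((4.2)–(4.3): `GaussWeight`; "[the] Cauchy integral formula":
Mathlib) or method references ("in a way similar to the proof of Lemma 8.1"). CLAIM (deduction node);
refines `Skeleton.Ded1524`/`Ded1617`/`Ded1710`, which consume `Skeleton.Lemma151`.
DAG `Z22:Lem15.1.pf` [Z22 p.106, tex L5248]. [cite: Zhang2022LandauSiegel, App. B pp.106–108] -/
def Lem15_1_pf : Prop := Skeleton.Lemma32 → Skeleton.Lemma151 c'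

end LemmaFifteenOneClaims

/-! ## Proof of Lemma 17.1 (pp. 108–109) -/

section LemmaSeventeenOne

variable {D : ℕ} [NeZero D] (χ : DirichletCharacter ℂ D)

/-- The Euler factor `1 + Σ_{r≥1} ν(pʳ)²/p^{rs}` of `Σ_n ν(n)²n^{−s}` at the prime `p`.
[cite: Zhang2022LandauSiegel, App. B p.108] -/
def eulerNuSq (p : ℕ) (s : ℂ) : ℂ :=
  1 + ∑' r : ℕ, Skeleton.nu χ (p ^ (r + 1)) ^ 2 / ((p : ℂ) ^ s) ^ (r + 1)

/-- The function whose residue at `s = 0` is taken (DAG `Z22:§B.u023`):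
`ζ(1+s)² L(1+s,χ)² ∏_{(p,D)=1}(1 − p^{−2(1+s)}) ∏_{p∣D}(1 − p^{−(1+s)}) · Tˢω₁(s)/s`
(`L(·,χ)` = Mathlib's completed `χ.LFunction`; `T = Skeleton.bigT D`; `ω₁ = GaussWeight.omega1 (𝓛³⁰)`).
[cite: Zhang2022LandauSiegel, App. B p.109] -/
def resFn171 (D : ℕ) [NeZero D] (χ : DirichletCharacter ℂ D) (s : ℂ) : ℂ :=
  riemannZeta (1 + s) ^ 2 * χ.LFunction (1 + s) ^ 2 *
    (∏' p : Nat.Primes, if (p : ℕ) ∣ D then (1 : ℂ) else 1 - (p : ℂ) ^ (-(2 * (1 + s)))) *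
    (∏ p ∈ D.primeFactors, (1 - (p : ℂ) ^ (-(1 + s)))) *
    ((Skeleton.bigT D : ℂ) ^ s * GaussWeight.omega1 (Skeleton.ell D ^ 30) s / s)

/-- "By Lemma 3.1, `Σ_{n<D⁴} ν(n)²/n = Σ_n ν(n)²/n · g(T/n) + o(1)`" (`g` of (4.1) = `Skeleton.gW`; the
tree's proof of Lemma 17.1 smooths with `e^{−n/X}` instead, `Lemma171.head_sub_le`/`tail_le` — this node
is the printed Gaussian smoothing). CLAIM. DAG `Z22:§B.u016` [Z22 p.108, tex L5341].
[cite: Zhang2022LandauSiegel, App. B proof of Lemma 17.1, p.108] -/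
def StepB_u016 : Prop :=
  ∀ ε : ℝ, 0 < ε → Skeleton.ForAllLarge fun D _ χ => Skeleton.AssumptionA D χ →
    ‖(∑ n ∈ Finset.range (D ^ 4), Skeleton.nu χ n ^ 2 / (n : ℂ)) -
        ∑' n : ℕ, Skeleton.nu χ n ^ 2 / (n : ℂ) * (Skeleton.gW D (Skeleton.bigT D / n) : ℂ)‖ ≤ ε

/-- "The sum on the right side is equal to `(1/2πi)∫_{(1)} (Σ_n ν(n)²/n^{1+s}) Tˢω₁(s)/s ds`"
(Mellin form of `g`, `GaussWeight.gWeight_eq_verticalIntegral`, summed under the integral). CLAIM (an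
identity for every large modulus). DAG `Z22:§B.u017` [Z22 p.108, tex L5345]. [cite: Zhang2022LandauSiegel, App. B p.108] -/
def StepB_u017 : Prop :=
  Skeleton.ForAllLarge fun D _ χ =>
    ∑' n : ℕ, Skeleton.nu χ n ^ 2 / (n : ℂ) * (Skeleton.gW D (Skeleton.bigT D / n) : ℂ) =
      vline 1 (fun s => LSeries (fun n => Skeleton.nu χ n ^ 2) (1 + s) *
        ((Skeleton.bigT D : ℂ) ^ s * GaussWeight.omega1 (Skeleton.ell D ^ 30) s / s))

/-- "Assume `σ > 1`. We have `Σ_n ν(n)²/nˢ = ∏_p (1 + Σ_r ν(pʳ)²/p^{rs})`" (Euler product of the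
multiplicative `ν²`; the tree's `tsum_divisorSumChar_sq_prime_pow` gives each factor in closed form).
CLAIM (for every modulus and character). DAG `Z22:§B.u018` [Z22 p.108, tex L5349].
[cite: Zhang2022LandauSiegel, App. B p.108] -/
def StepB_u018 : Prop :=
  ∀ (D : ℕ) [NeZero D] (χ : DirichletCharacter ℂ D), ∀ s : ℂ, 1 < s.re →
    LSeries (fun n => Skeleton.nu χ n ^ 2) s = ∏' p : Nat.Primes, eulerNuSq χ p s

/-- "If `χ(p) = 1`, then (see [19, (1.2.10)])
`1 + Σ_r ν(pʳ)²/p^{rs} = (1 − p^{−s})^{−4}(1 − p^{−2s}) = (1 − p^{−s})^{−2}(1 − χ(p)p^{−s})^{−2}(1 − p^{−2s})`"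
(Ramanujan's local factor; the chain typed as the conjunction of its two equalities). CLAIM.
DAG `Z22:§B.u019` [Z22 p.108, tex L5353]. [cite: Zhang2022LandauSiegel, App. B p.108] -/
def StepB_u019 : Prop :=
  ∀ (D : ℕ) [NeZero D] (χ : DirichletCharacter ℂ D), ∀ p : ℕ, p.Prime → ∀ s : ℂ, 1 < s.re →
    χ (p : ZMod D) = 1 →
      eulerNuSq χ p s = ((1 - (p : ℂ) ^ (-s)) ^ 4)⁻¹ * (1 - (p : ℂ) ^ (-(2 * s))) ∧
        ((1 - (p : ℂ) ^ (-s)) ^ 4)⁻¹ * (1 - (p : ℂ) ^ (-(2 * s))) =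
          ((1 - (p : ℂ) ^ (-s)) ^ 2)⁻¹ * ((1 - χ (p : ZMod D) * (p : ℂ) ^ (-s)) ^ 2)⁻¹ *
            (1 - (p : ℂ) ^ (-(2 * s)))

/-- "if `χ(p) = −1`, then
`1 + Σ_r ν(pʳ)²/p^{rs} = 1 + Σ_r 1/p^{2rs} = (1 − p^{−2s})^{−1} = (1 − p^{−s})^{−2}(1 − χ(p)p^{−s})^{−2}(1 − p^{−2s})`"
(three equalities). CLAIM. DAG `Z22:§B.u020` [Z22 p.109, tex L5357]. [cite: Zhang2022LandauSiegel, App. B p.109] -/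
def StepB_u020 : Prop :=
  ∀ (D : ℕ) [NeZero D] (χ : DirichletCharacter ℂ D), ∀ p : ℕ, p.Prime → ∀ s : ℂ, 1 < s.re →
    χ (p : ZMod D) = -1 →
      eulerNuSq χ p s = 1 + ∑' r : ℕ, 1 / ((p : ℂ) ^ (2 * s)) ^ (r + 1) ∧
        1 + ∑' r : ℕ, 1 / ((p : ℂ) ^ (2 * s)) ^ (r + 1) = (1 - (p : ℂ) ^ (-(2 * s)))⁻¹ ∧
          (1 - (p : ℂ) ^ (-(2 * s)))⁻¹ =
            ((1 - (p : ℂ) ^ (-s)) ^ 2)⁻¹ * ((1 - χ (p : ZMod D) * (p : ℂ) ^ (-s)) ^ 2)⁻¹ *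
              (1 - (p : ℂ) ^ (-(2 * s)))

/-- "if `χ(p) = 0`, then
`1 + Σ_r ν(pʳ)²/p^{rs} = 1 + Σ_r 1/p^{rs} = (1 − p^{−s})^{−1} = (1 − p^{−s})^{−2}(1 − χ(p)p^{−s})^{−2}(1 − p^{−s})`"
(three equalities). CLAIM. DAG `Z22:§B.u021` [Z22 p.109, tex L5361]. [cite: Zhang2022LandauSiegel, App. B p.109] -/
def StepB_u021 : Prop :=
  ∀ (D : ℕ) [NeZero D] (χ : DirichletCharacter ℂ D), ∀ p : ℕ, p.Prime → ∀ s : ℂ, 1 < s.re →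
    χ (p : ZMod D) = 0 →
      eulerNuSq χ p s = 1 + ∑' r : ℕ, 1 / ((p : ℂ) ^ s) ^ (r + 1) ∧
        1 + ∑' r : ℕ, 1 / ((p : ℂ) ^ s) ^ (r + 1) = (1 - (p : ℂ) ^ (-s))⁻¹ ∧
          (1 - (p : ℂ) ^ (-s))⁻¹ =
            ((1 - (p : ℂ) ^ (-s)) ^ 2)⁻¹ * ((1 - χ (p : ZMod D) * (p : ℂ) ^ (-s)) ^ 2)⁻¹ *
              (1 - (p : ℂ) ^ (-s))

/-- "Hence `Σ_n ν(n)²/nˢ = ζ(s)²L(s,χ)² ∏_{(p,D)=1}(1 − p^{−2s}) ∏_{p∣D}(1 − p^{−s})`" (`σ > 1`, `χ` real,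
i.e. `χ² = 1`) — word for word the tree's `LSeries_divisorSumChar_sq_of_sq_eq_one` (`stepB_u022_holds`).
CLAIM. DAG `Z22:§B.u022` [Z22 p.109, tex L5365]. [cite: Zhang2022LandauSiegel, App. B p.109] -/
def StepB_u022 : Prop :=
  ∀ (D : ℕ) [NeZero D] (χ : DirichletCharacter ℂ D), χ ^ 2 = 1 → ∀ s : ℂ, 1 < s.re →
    LSeries (fun n => Skeleton.nu χ n ^ 2) s =
      riemannZeta s ^ 2 * (L ↗χ s) ^ 2 *
        (∏' p : Nat.Primes, if (p : ℕ) ∣ D then (1 : ℂ) else 1 - (p : ℂ) ^ (-(2 * s))) *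
        ∏ p ∈ D.primeFactors, (1 - (p : ℂ) ^ (-s))

/-- **`Z22:§B.u022` is a theorem of the tree**: Ramanujan's identity twisted by a real character,
`Literature.NumberTheory.LFunctions.LSeries_divisorSumChar_sq_of_sq_eq_one` (`Skeleton.nu χ` is the
tree's `divisorSumChar χ` by definition). [cite: Zhang2022LandauSiegel, App. B p.109] -/
theorem stepB_u022_holds : StepB_u022 := fun _ _ χ hχ _ hs =>
  Literature.NumberTheory.LFunctions.LSeries_divisorSumChar_sq_of_sq_eq_one χ hχ hs

/-- "In a way similar to the proof of, by (A) and simple estimate, we find that the integral (14) is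
equal to the residue of the function [`resFn171`] at `s = 0`, plus an acceptable error `O`" — FLAGS:
dangling "proof of," and "(14)" (= the integral of `StepB_u017`) in print (tex L5368), bare "`O`" read
`o(1)`; the residue at the triple pole typed as `(2πi)⁻¹∮_{|s| = 1/4}` (no other singularity there:
`L(1+s,χ)` is entire, the products converge for `Re s > −1/2`). CLAIM. DAG `Z22:§B.u023`
[Z22 p.109, tex L5369]. [cite: Zhang2022LandauSiegel, App. B p.109] -/
def StepB_u023 : Prop :=
  ∀ ε : ℝ, 0 < ε → Skeleton.ForAllLarge fun D _ χ => Skeleton.AssumptionA D χ →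
    ‖vline 1 (fun s => LSeries (fun n => Skeleton.nu χ n ^ 2) (1 + s) *
          ((Skeleton.bigT D : ℂ) ^ s * GaussWeight.omega1 (Skeleton.ell D ^ 30) s / s)) -
        (2 * π * I)⁻¹ * (∮ s in C((0 : ℂ), 1 / 4), resFn171 D χ s)‖ ≤ ε

/-- "which is equal to `L′(1,χ)² ∏_p(1 − p⁻²) ∏_{p∣D}(1 − p⁻¹)(1 − p⁻²)⁻¹ + o(1)`" (the leading term of
the residue at the triple pole; the lower-order terms carry factors `L(1,χ)`, small under (A); tree
`Lemma171.residue_eq`, `Lemma171.norm_residue_sub_le`). CLAIM. DAG `Z22:§B.u024` (first relation)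
[Z22 p.109, tex L5373]. [cite: Zhang2022LandauSiegel, App. B p.109] -/
def StepB_u024a : Prop :=
  ∀ ε : ℝ, 0 < ε → Skeleton.ForAllLarge fun D _ χ => Skeleton.AssumptionA D χ →
    ‖(2 * π * I)⁻¹ * (∮ s in C((0 : ℂ), 1 / 4), resFn171 D χ s) -
        deriv χ.LFunction 1 ^ 2 * (∏' p : Nat.Primes, (1 - ((p : ℂ) ^ 2)⁻¹)) *
          ∏ p ∈ D.primeFactors, ((1 - (p : ℂ)⁻¹) * (1 - ((p : ℂ) ^ 2)⁻¹)⁻¹)‖ ≤ ε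

/-- "`L′(1,χ)² ∏_p(1 − p⁻²) ∏_{p∣D}(1 − p⁻¹)(1 − p⁻²)⁻¹ … = 𝔞`" (`∏_p(1 − p⁻²) = ζ(2)⁻¹ = 6/π²`,
`(1 − p⁻¹)(1 − p⁻²)⁻¹ = p/(p+1)`; `𝔞` of (2.31) = `Skeleton.frakA χ`; tree `Lemma171.phi_one_eq`,
`Lemma171.frakAC_eq`, Mathlib `riemannZeta_two`). CLAIM (an exact identity for the real primitive `χ`).
DAG `Z22:§B.u024` (second relation) [Z22 p.109, tex L5373]. [cite: Zhang2022LandauSiegel, App. B p.109] -/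
def StepB_u024b : Prop :=
  Skeleton.ForAllLarge fun D _ χ =>
    deriv χ.LFunction 1 ^ 2 * (∏' p : Nat.Primes, (1 - ((p : ℂ) ^ 2)⁻¹)) *
        ∏ p ∈ D.primeFactors, ((1 - (p : ℂ)⁻¹) * (1 - ((p : ℂ) ^ 2)⁻¹)⁻¹) =
      (Skeleton.frakA χ : ℂ)

/-- **The proof block of Lemma 17.1** (Appendix B, pp. 108–109) as ONE named implication from its cited
input: Lemma 3.1 (`Skeleton.Lemma31`, itself a theorem of the tree) ⇒ Lemma 17.1 (`Skeleton.AppBLemma171`),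
through `StepB_u016`–`StepB_u024b` ("[19, (1.2.10)]" = Titchmarsh, a theorem of the tree). CLAIM
(deduction node) — DISCHARGED: `lem17_1_pf_holds`. DAG `Z22:Lem17.1.pf` [Z22 p.108, tex L5340].
[cite: Zhang2022LandauSiegel, App. B pp.108–109] -/
def Lem17_1_pf : Prop := Skeleton.Lemma31 → Skeleton.AppBLemma171

/-- **`Z22:Lem17.1.pf` is discharged in the tree**: Lemma 17.1 is the theorem
`Skeleton.appBLemma171_holds` (`Lemma171.lemma_17_1`, Appendix B kernel-checked with the rate `𝓛⁻²⁰¹¹`).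
[cite: Zhang2022LandauSiegel, §17 Lemma 17.1, App. B] -/
theorem lem17_1_pf_holds : Lem17_1_pf := fun _ => Skeleton.appBLemma171_holds

end LemmaSeventeenOne

/-! ## Discharges of the identity leaves (kernel-checked) -/

section Discharges

/-- **`Z22:§B.u004` lead-in is a theorem**: if `h > 1` is coprime to `𝔮 = ∏_{q<D⁴} q` then `h > D⁴`
(the least prime factor of `h` is not below `D⁴`, and `D⁴` is not prime).
[cite: Zhang2022LandauSiegel, App. B p.106] -/
theorem stepB_u004h_holds : StepB_u004h := by
  intro D h hh hcop
  by_contra hle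
  push Not at hle
  have h0 : h ≠ 1 := by omega
  have hq : h.minFac.Prime := Nat.minFac_prime h0
  have hqh : h.minFac ∣ h := Nat.minFac_dvd h
  have hqle : h.minFac ≤ h := Nat.minFac_le (by omega)
  rcases lt_or_eq_of_le (le_trans hqle hle) with hlt | heq
  · have hdvd : h.minFac ∣ Skeleton.frakq D :=
      Finset.dvd_prod_of_mem _ (Finset.mem_filter.mpr ⟨Finset.mem_range.mpr hlt, hq⟩)
    have h1 : h.minFac ∣ Nat.gcd h (Skeleton.frakq D) := Nat.dvd_gcd hqh hdvd
    rw [Nat.Coprime.gcd_eq_one hcop, Nat.dvd_one] at h1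
    exact hq.one_lt.ne' h1
  · -- `h.minFac = D⁴`, hence `h = D⁴` is prime: impossible
    have hh4 : h = D ^ 4 := le_antisymm hle (heq ▸ hqle)
    have hp : (D ^ 4).Prime := by rw [← heq]; exact hq
    have hD : D ∣ D ^ 4 := dvd_pow_self D (by norm_num)
    rcases hp.eq_one_or_self_of_dvd D hD with hD1 | hD4
    · rw [hD1] at hp; norm_num at hp
    · have hD2 : 2 ≤ D := by
        rcases Nat.lt_or_ge D 2 with hlt2 | hge
        · interval_cases D <;> norm_num at hp
        · exact hge
      have : D < D ^ 4 := by
        calc D = D ^ 1 := (pow_one D).symm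
          _ < D ^ 4 := Nat.pow_lt_pow_right hD2 (by norm_num)
      omega

/-- The shift `β_j` is purely imaginary: `β_j = b·i` for a real `b`. [cite: Zhang2022LandauSiegel, §2 (2.13)] -/
theorem betaJ_eq_mul_I (c' : ℝ) (D j : ℕ) : ∃ b : ℝ, Skeleton.betaJ c' D j = (b : ℂ) * I := by
  unfold Skeleton.betaJ Skeleton.beta1 Skeleton.beta2 Skeleton.beta3
  split_ifs
  · exact ⟨Skeleton.alpha D * (1 - 5 * c' * Skeleton.alpha D * Skeleton.ell D), by push_cast; ring⟩
  · exact ⟨2 * Skeleton.alpha D * (1 + c' * Skeleton.alpha D * Skeleton.ell D), by push_cast; ring⟩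
  · exact ⟨3 * Skeleton.alpha D * (1 - c' * Skeleton.alpha D * Skeleton.ell D), by push_cast; ring⟩

/-- `re β_j = 0`. [cite: Zhang2022LandauSiegel, §2 (2.13)] -/
theorem betaJ_re (c' : ℝ) (D j : ℕ) : (Skeleton.betaJ c' D j).re = 0 := by
  obtain ⟨b, hb⟩ := betaJ_eq_mul_I c' D j
  simp [hb]

/-- Termwise shift: `f(n) n^{β} / n^{s} = f(n) / n^{s−β}` (`n ≥ 1`; both `0` at `n = 0`). [folklore] -/
private theorem term_mul_cpow_eq (f : ℕ → ℂ) (β s : ℂ) (n : ℕ) :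
    LSeries.term (fun n => f n * (n : ℂ) ^ β) s n = LSeries.term f (s - β) n := by
  rcases eq_or_ne n 0 with rfl | hn
  · simp [LSeries.term]
  have hn' : (n : ℂ) ≠ 0 := Nat.cast_ne_zero.mpr hn
  have hnb : (n : ℂ) ^ β ≠ 0 := by
    rw [Ne, Complex.cpow_eq_zero_iff]; exact fun h => hn' h.1
  rw [LSeries.term_of_ne_zero hn, LSeries.term_of_ne_zero hn, Complex.cpow_sub _ _ hn']
  field_simp

/-- `Σ_{n≥1} f(n) n^{β} n^{−s} = Σ_{n≥1} f(n) n^{−(s−β)}` (as `L`-series, every `s`). [folklore] -/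
private theorem LSeries_mul_cpow_eq (f : ℕ → ℂ) (β s : ℂ) :
    LSeries (fun n => f n * (n : ℂ) ^ β) s = LSeries f (s - β) := by
  unfold LSeries
  exact tsum_congr fun n => term_mul_cpow_eq f β s n

/-- **`Z22:§B.u007` is a theorem**: `Σ_l ϱ_j(l)l^{−s} = ζ(s)/ζ(s − β_j)` for `σ > 1`
(`ϱ_j = (μ·n^{β_j}) ∗ 1`; Mathlib's `LSeries_convolution'`, `L 1 = ζ`, `L 1 · L μ = 1`).
[cite: Zhang2022LandauSiegel, App. B p.107] -/
theorem stepB_u007_holds (c' : ℝ) : StepB_u007 c' := by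
  intro D j _ s hs
  set β := Skeleton.betaJ c' D j with hβdef
  have hβ : β.re = 0 := betaJ_re c' D j
  have hs' : 1 < (s - β).re := by simp [hβ]; exact hs
  -- `ϱ_j = (μ · n^β) ⍟ 1`
  set c : ℕ → ℂ := fun n => (ArithmeticFunction.moebius n : ℂ) * (n : ℂ) ^ β with hc
  have hconv : (fun l => varrhoJ c' D j l) = c ⍟ (1 : ℕ → ℂ) := by
    funext l
    rw [LSeries.convolution_def]
    simp only [Pi.one_apply, mul_one]
    rw [varrhoJ, ← Nat.sum_divisorsAntidiagonal fun d _ => (ArithmeticFunction.moebius d : ℂ) * (d : ℂ) ^ β]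
  -- summability
  have hμ : LSeriesSummable (fun n => (ArithmeticFunction.moebius n : ℂ)) (s - β) :=
    ArithmeticFunction.LSeriesSummable_moebius_iff.mpr hs'
  have hcS : LSeriesSummable c s := by
    unfold LSeriesSummable at hμ ⊢
    rw [show LSeries.term c s = LSeries.term (fun n => (ArithmeticFunction.moebius n : ℂ)) (s - β)
      from funext (term_mul_cpow_eq _ β s)]
    exact hμ
  have h1 : LSeriesSummable (1 : ℕ → ℂ) s := LSeriesSummable_one_iff.mpr hs
  rw [hconv, LSeries_convolution' hcS h1, hc, LSeries_mul_cpow_eq, LSeries_one_eq_riemannZeta hs]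
  have hμinv : LSeries (fun n => (ArithmeticFunction.moebius n : ℂ)) (s - β) =
      (riemannZeta (s - β))⁻¹ := by
    have h := LSeries_one_mul_Lseries_moebius hs'
    rw [LSeries_one_eq_riemannZeta hs'] at h
    exact eq_inv_of_mul_eq_one_right h
  rw [hμinv, div_eq_mul_inv, mul_comm]

variable (c' : ℝ) in
/-- `StepB_u007` — `_holds` alias of `stepB_u007_holds` above under the fact's exact name, stated under the
prover's own binders as section variables (appended 2026-08-28, D-0026 bookkeeping: the proof term is the
existing theorem of this file; no statement, definition or attribute is edited; no new named fact; the
ledger's debt table listed the fact unproved). [cite: Zhang2022LandauSiegel, App. B p.107] -/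
theorem _root_.Literature.NumberTheory.LFunctions.Zhang2022.Typed.AppendixB.StepB_u007_holds :
    _root_.Literature.NumberTheory.LFunctions.Zhang2022.Typed.AppendixB.StepB_u007 c' :=
  _root_.Literature.NumberTheory.LFunctions.Zhang2022.Typed.AppendixB.stepB_u007_holds (c' := c')


/-- `1 − u ≠ 0` for `‖u‖ < 1`. [folklore] -/
private theorem one_sub_ne_zero_of_norm_lt_one {u : ℂ} (hu : ‖u‖ < 1) : 1 - u ≠ 0 := by
  intro h
  have : u = 1 := by linear_combination -h
  rw [this, norm_one] at hu
  exact lt_irrefl _ hu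

/-- `‖p^{−s}‖ < 1` for a prime `p` and `re s > 1`. [folklore] -/
private theorem norm_prime_cpow_neg_lt_one {p : ℕ} (hp : p.Prime) {s : ℂ} (hs : 1 < s.re) :
    ‖(p : ℂ) ^ (-s)‖ < 1 := by
  rw [Complex.norm_natCast_cpow_of_pos hp.pos, neg_re]
  exact Real.rpow_lt_one_of_one_lt_of_neg (by exact_mod_cast hp.one_lt) (by linarith)

/-- **The local factor in closed form** (Ramanujan / Titchmarsh (1.2.10), the tree's
`tsum_divisorSumChar_sq_prime_pow`): with `x = p^{−s}`, `w = χ(p)`,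
`1 + Σ_{r≥1} ν(pʳ)²/p^{rs} = (1 + wx)/((1 − x)(1 − wx)(1 − w²x))` (`re s > 1`).
[cite: Titchmarsh1986, (1.2.10)] -/
theorem hasSum_nu_sq_prime_pow {D : ℕ} [NeZero D] (χ : DirichletCharacter ℂ D) {p : ℕ}
    (hp : p.Prime) {s : ℂ} (hs : 1 < s.re) :
    HasSum (fun e : ℕ => Skeleton.nu χ (p ^ e) ^ 2 * ((p : ℂ) ^ (-s)) ^ e)
      ((1 + χ (p : ZMod D) * (p : ℂ) ^ (-s)) /
        ((1 - (p : ℂ) ^ (-s)) * (1 - χ (p : ZMod D) * (p : ℂ) ^ (-s)) *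
          (1 - χ (p : ZMod D) ^ 2 * (p : ℂ) ^ (-s)))) := by
  have hx : ‖(p : ℂ) ^ (-s)‖ < 1 := norm_prime_cpow_neg_lt_one hp hs
  simp only [Skeleton.nu, Literature.NumberTheory.LFunctions.divisorSumChar_prime_pow χ hp]
  exact Literature.NumberTheory.LFunctions.hasSum_geomPartialSum_sq_mul_pow (χ.norm_le_one _) hx

/-- The Euler factor as the full series over `e ≥ 0`: `1 + Σ_{r≥1} ν(pʳ)²/p^{rs} = Σ_{e≥0} ν(pᵉ)²(p^{−s})ᵉ`
(`re s > 1`). [cite: Zhang2022LandauSiegel, App. B p.108] -/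
theorem eulerNuSq_eq_tsum {D : ℕ} [NeZero D] (χ : DirichletCharacter ℂ D) {p : ℕ} (hp : p.Prime)
    {s : ℂ} (hs : 1 < s.re) :
    eulerNuSq χ p s = ∑' e : ℕ, Skeleton.nu χ (p ^ e) ^ 2 * ((p : ℂ) ^ (-s)) ^ e := by
  have hsum := hasSum_nu_sq_prime_pow χ hp hs
  have hterm : ∀ r : ℕ, Skeleton.nu χ (p ^ (r + 1)) ^ 2 / ((p : ℂ) ^ s) ^ (r + 1) =
      Skeleton.nu χ (p ^ (r + 1)) ^ 2 * ((p : ℂ) ^ (-s)) ^ (r + 1) := by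
    intro r
    rw [Complex.cpow_neg, inv_pow, div_eq_mul_inv]
  have h0 : Skeleton.nu χ (p ^ 0) ^ 2 * ((p : ℂ) ^ (-s)) ^ 0 = 1 := by
    simp [Skeleton.nu]
  unfold eulerNuSq
  simp_rw [hterm]
  rw [hsum.summable.tsum_eq_zero_add, h0]

/-- **The local factor in closed form** (Ramanujan / Titchmarsh (1.2.10), the tree's
`hasSum_geomPartialSum_sq_mul_pow`): with `x = p^{−s}`, `w = χ(p)`,
`1 + Σ_{r≥1} ν(pʳ)²/p^{rs} = (1 + wx)/((1 − x)(1 − wx)(1 − w²x))` (`re s > 1`).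
[cite: Titchmarsh1986, (1.2.10)] -/
theorem eulerNuSq_eq {D : ℕ} [NeZero D] (χ : DirichletCharacter ℂ D) {p : ℕ} (hp : p.Prime)
    {s : ℂ} (hs : 1 < s.re) :
    eulerNuSq χ p s =
      (1 + χ (p : ZMod D) * (p : ℂ) ^ (-s)) /
        ((1 - (p : ℂ) ^ (-s)) * (1 - χ (p : ZMod D) * (p : ℂ) ^ (-s)) *
          (1 - χ (p : ZMod D) ^ 2 * (p : ℂ) ^ (-s))) := by
  rw [eulerNuSq_eq_tsum χ hp hs, (hasSum_nu_sq_prime_pow χ hp hs).tsum_eq]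

/-- **`Z22:§B.u018` is a theorem**: the Euler product `Σ_n ν(n)²n^{−s} = ∏_p (1 + Σ_r ν(pʳ)²p^{−rs})`,
`σ > 1` (`ν²` is multiplicative and `Σ |ν(n)|² n^{−σ} < ∞` by the divisor bound; Mathlib's
`EulerProduct.eulerProduct_hasProd`). [cite: Zhang2022LandauSiegel, App. B p.108] -/
theorem stepB_u018_holds : StepB_u018 := by
  intro D _ χ s hs
  have hs0 : s ≠ 0 := by
    rintro rfl
    rw [Complex.zero_re] at hs
    linarith
  set F : ℕ → ℂ := fun n => Skeleton.nu χ n ^ 2 * riemannZetaSummandHom hs0 n with hF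
  have hFx : ∀ n, riemannZetaSummandHom hs0 n = (n : ℂ) ^ (-s) := fun n => rfl
  have hFterm : ∀ n, F n = LSeries.term (fun n => Skeleton.nu χ n ^ 2) s n := by
    intro n
    rw [LSeries.term_def₀ (by simp [Skeleton.nu]) s n]
    rfl
  have hF0 : F 0 = 0 := by simp [hF, Skeleton.nu]
  have hF1 : F 1 = 1 := by simp [hF, Skeleton.nu]
  have hmul : ∀ {m n : ℕ}, m.Coprime n → F (m * n) = F m * F n := by
    intro m n hmn
    simp only [hF, Skeleton.nu, Literature.NumberTheory.LFunctions.divisorSumChar_mul_of_coprime χ hmn,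
      map_mul]
    ring
  have hsum : Summable (fun n => ‖F n‖) := by
    obtain ⟨C, hC1, hC⟩ :=
      Literature.NumberTheory.Sieve.exists_card_divisors_le_mul_rpow' (ε := (s.re - 1) / 4)
        (by linarith)
    have hmaj : Summable (fun n : ℕ => C ^ 2 * (n : ℝ) ^ (-((s.re + 1) / 2))) := by
      refine (Real.summable_nat_rpow.mpr ?_).mul_left _
      linarith
    refine hmaj.of_nonneg_of_le (fun _ => norm_nonneg _) fun n => ?_
    rcases eq_or_ne n 0 with rfl | hn
    · simp [hF0, Real.zero_rpow (by linarith : -((s.re + 1) / 2) ≠ 0)]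
    · have hn' : 0 < (n : ℝ) := by positivity
      rw [hF, norm_mul, norm_pow, hFx, Complex.norm_natCast_cpow_of_pos (Nat.pos_of_ne_zero hn),
        neg_re]
      have hd : ‖Skeleton.nu χ n‖ ≤ C * (n : ℝ) ^ ((s.re - 1) / 4) :=
        (Literature.NumberTheory.LFunctions.norm_divisorSumChar_le χ n).trans (hC n)
      calc ‖Skeleton.nu χ n‖ ^ 2 * (n : ℝ) ^ (-s.re)
          ≤ (C * (n : ℝ) ^ ((s.re - 1) / 4)) ^ 2 * (n : ℝ) ^ (-s.re) := by
            gcongr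
        _ = C ^ 2 * ((n : ℝ) ^ ((s.re - 1) / 4 * 2) * (n : ℝ) ^ (-s.re)) := by
            rw [mul_pow, Real.rpow_mul hn'.le]; norm_cast; ring
        _ = C ^ 2 * (n : ℝ) ^ (-((s.re + 1) / 2)) := by
            rw [← Real.rpow_add hn']; congr 1; ring_nf
  have hE := EulerProduct.eulerProduct_hasProd hF1 hmul hsum hF0
  have hL : ∑' n, F n = LSeries (fun n => Skeleton.nu χ n ^ 2) s := by
    simp_rw [hFterm]; rfl
  rw [hL] at hE
  have heq : (fun p : Nat.Primes => ∑' e : ℕ, F (p ^ e)) = fun p : Nat.Primes => eulerNuSq χ p s := by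
    funext p
    have hFp : ∀ e : ℕ, F (p ^ e) = Skeleton.nu χ (p ^ e) ^ 2 * ((p : ℂ) ^ (-s)) ^ e := by
      intro e
      simp only [hF]
      rw [map_pow, hFx]
    simp_rw [hFp]
    exact (eulerNuSq_eq_tsum χ p.prop hs).symm
  rw [heq] at hE
  exact hE.tprod_eq.symm

/-- **`Z22:§B.u019` is a theorem** (the case `χ(p) = 1`). [cite: Zhang2022LandauSiegel, App. B p.108] -/
theorem stepB_u019_holds : StepB_u019 := by
  intro D _ χ p hp s hs hχp
  have hx : ‖(p : ℂ) ^ (-s)‖ < 1 := norm_prime_cpow_neg_lt_one hp hs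
  have h1 : 1 - (p : ℂ) ^ (-s) ≠ 0 := one_sub_ne_zero_of_norm_lt_one hx
  have hx2 : (p : ℂ) ^ (-(2 * s)) = ((p : ℂ) ^ (-s)) ^ 2 := by
    rw [show -(2 * s) = 2 * (-s) by ring, Complex.cpow_ofNat_mul]
  rw [eulerNuSq_eq χ hp hs, hχp, hx2]
  set x : ℂ := (p : ℂ) ^ (-s)
  constructor
  · field_simp
    ring
  · field_simp

/-- **`Z22:§B.u020` is a theorem** (the case `χ(p) = −1`; the middle series is geometric in `p^{−2s}`).
[cite: Zhang2022LandauSiegel, App. B p.109] -/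
theorem stepB_u020_holds : StepB_u020 := by
  intro D _ χ p hp s hs hχp
  have hx : ‖(p : ℂ) ^ (-s)‖ < 1 := norm_prime_cpow_neg_lt_one hp hs
  have h1 : 1 - (p : ℂ) ^ (-s) ≠ 0 := one_sub_ne_zero_of_norm_lt_one hx
  have h1' : 1 + (p : ℂ) ^ (-s) ≠ 0 := by
    have := one_sub_ne_zero_of_norm_lt_one (u := -(p : ℂ) ^ (-s)) (by rwa [norm_neg])
    rwa [sub_neg_eq_add] at this
  have hx2 : (p : ℂ) ^ (-(2 * s)) = ((p : ℂ) ^ (-s)) ^ 2 := by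
    rw [show -(2 * s) = 2 * (-s) by ring, Complex.cpow_ofNat_mul]
  have hy : ‖((p : ℂ) ^ (-s)) ^ 2‖ < 1 := by
    rw [norm_pow]; exact pow_lt_one₀ (norm_nonneg _) hx (by norm_num)
  have h2 : 1 - ((p : ℂ) ^ (-s)) ^ 2 ≠ 0 := one_sub_ne_zero_of_norm_lt_one hy
  -- the geometric series `1 + Σ_{r≥0} y^{r+1} = (1 − y)⁻¹`, `y = p^{−2s}`
  have hgeom : 1 + ∑' r : ℕ, 1 / ((p : ℂ) ^ (2 * s)) ^ (r + 1) = (1 - ((p : ℂ) ^ (-s)) ^ 2)⁻¹ := by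
    have hterm : ∀ r : ℕ, 1 / ((p : ℂ) ^ (2 * s)) ^ (r + 1) = (((p : ℂ) ^ (-s)) ^ 2) ^ (r + 1) := by
      intro r
      rw [Complex.cpow_ofNat_mul, Complex.cpow_neg, inv_pow, inv_pow, one_div]
    simp_rw [hterm]
    have hS : Summable fun e : ℕ => (((p : ℂ) ^ (-s)) ^ 2) ^ e :=
      summable_geometric_of_norm_lt_one hy
    rw [← tsum_geometric_of_norm_lt_one hy, hS.tsum_eq_zero_add, pow_zero]
  rw [eulerNuSq_eq χ hp hs, hχp, hx2, hgeom]
  set x : ℂ := (p : ℂ) ^ (-s)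
  refine ⟨?_, rfl, ?_⟩
  · have hden : (1 - x) * (1 - -1 * x) * (1 - (-1) ^ 2 * x) ≠ 0 := by
      have e1 : (1 : ℂ) - -1 * x = 1 + x := by ring
      have e2 : (1 : ℂ) - (-1) ^ 2 * x = 1 - x := by ring
      rw [e1, e2]
      exact mul_ne_zero (mul_ne_zero h1 h1') h1
    rw [inv_eq_one_div, div_eq_div_iff hden h2]
    ring
  · rw [← mul_inv, ← mul_pow, show (1 - x) * (1 - -1 * x) = 1 - x ^ 2 by ring, pow_two (1 - x ^ 2),
      mul_inv, mul_assoc, inv_mul_cancel₀ h2, mul_one]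

/-- **`Z22:§B.u021` is a theorem** (the case `χ(p) = 0`; the middle series is geometric in `p^{−s}`).
[cite: Zhang2022LandauSiegel, App. B p.109] -/
theorem stepB_u021_holds : StepB_u021 := by
  intro D _ χ p hp s hs hχp
  have hx : ‖(p : ℂ) ^ (-s)‖ < 1 := norm_prime_cpow_neg_lt_one hp hs
  have h1 : 1 - (p : ℂ) ^ (-s) ≠ 0 := one_sub_ne_zero_of_norm_lt_one hx
  have hgeom : 1 + ∑' r : ℕ, 1 / ((p : ℂ) ^ s) ^ (r + 1) = (1 - (p : ℂ) ^ (-s))⁻¹ := by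
    have hterm : ∀ r : ℕ, 1 / ((p : ℂ) ^ s) ^ (r + 1) = ((p : ℂ) ^ (-s)) ^ (r + 1) := by
      intro r
      rw [Complex.cpow_neg, inv_pow, one_div]
    simp_rw [hterm]
    have hS : Summable fun e : ℕ => ((p : ℂ) ^ (-s)) ^ e := summable_geometric_of_norm_lt_one hx
    rw [← tsum_geometric_of_norm_lt_one hx, hS.tsum_eq_zero_add, pow_zero]
  rw [eulerNuSq_eq χ hp hs, hχp, hgeom]
  set x : ℂ := (p : ℂ) ^ (-s)
  refine ⟨?_, rfl, ?_⟩
  · simp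
  · simp only [zero_mul, sub_zero, one_pow, inv_one, mul_one]
    rw [pow_two (1 - x), mul_inv, mul_assoc, inv_mul_cancel₀ h1, mul_one]

/-- **`Z22:§B.u024`, second relation, is a theorem**:
`L′(1,χ)² ∏_p(1 − p⁻²) ∏_{p∣D}(1 − p⁻¹)(1 − p⁻²)⁻¹ = 𝔞` (`∏_p(1 − p⁻²) = ζ(2)⁻¹ = 6/π²`, Mathlib's
Euler product and `riemannZeta_two`; `(1 − p⁻¹)/(1 − p⁻²) = p/(p+1)`; `𝔞` of (2.31) via the tree's
`Lemma171.frakAC_eq`). [cite: Zhang2022LandauSiegel, App. B p.109] -/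
theorem stepB_u024b_holds : StepB_u024b := by
  refine ⟨3, fun D _ χ hD hq hprim => ?_⟩
  dsimp only
  have hχ1 : χ ≠ 1 := Skeleton.ne_one_of_isPrimitive_of_three_le hprim hD
  have hχ2 : χ ^ 2 = 1 := hq.sq_eq_one
  -- the Euler product of `ζ(2)`, inverted
  have h2 : 1 < (2 : ℂ).re := by norm_num
  have hπ : (π : ℂ) ≠ 0 := by exact_mod_cast Real.pi_ne_zero
  have hζ : riemannZeta 2 ≠ 0 := by
    rw [riemannZeta_two]; exact div_ne_zero (pow_ne_zero 2 hπ) (by norm_num)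
  have E := riemannZeta_eulerProduct_hasProd h2
  have E' : HasProd (fun p : Nat.Primes => ((1 - (p : ℂ) ^ (-(2 : ℂ)))⁻¹)⁻¹) (riemannZeta 2)⁻¹ := by
    unfold HasProd at E ⊢
    have := E.inv₀ hζ
    simpa only [Finset.prod_inv_distrib] using this
  have hfun : (fun p : Nat.Primes => ((1 - (p : ℂ) ^ (-(2 : ℂ)))⁻¹)⁻¹) =
      fun p : Nat.Primes => 1 - (((p : ℕ) : ℂ) ^ 2)⁻¹ := by
    funext p
    rw [inv_inv, Complex.cpow_neg, Complex.cpow_two]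
  rw [hfun] at E'
  have hprod : (∏' p : Nat.Primes, (1 - (((p : ℕ) : ℂ) ^ 2)⁻¹)) = (riemannZeta 2)⁻¹ := E'.tprod_eq
  -- the finite Euler factor
  have hfin : ∏ p ∈ D.primeFactors, ((1 - (p : ℂ)⁻¹) * (1 - ((p : ℂ) ^ 2)⁻¹)⁻¹) =
      ∏ p ∈ D.primeFactors, ((p : ℂ) / (p + 1)) := by
    refine Finset.prod_congr rfl fun p hp => ?_
    have hp2 : 2 ≤ p := (Nat.prime_of_mem_primeFactors hp).two_le
    have hp0 : (p : ℂ) ≠ 0 := by exact_mod_cast (show p ≠ 0 by omega)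
    have hp1 : (p : ℂ) + 1 ≠ 0 := by exact_mod_cast (show p + 1 ≠ 0 by omega)
    have hpm : (p : ℂ) - 1 ≠ 0 := by
      have : ((p - 1 : ℕ) : ℂ) ≠ 0 := by exact_mod_cast (show p - 1 ≠ 0 by omega)
      rwa [Nat.cast_sub (by omega : 1 ≤ p), Nat.cast_one] at this
    have hsq : 1 - ((p : ℂ) ^ 2)⁻¹ = (p - 1) * (p + 1) / (p : ℂ) ^ 2 := by
      field_simp
      ring
    rw [hsq]
    field_simp
  rw [hprod, hfin, riemannZeta_two]
  change _ = ((Lemma171.frakA χ : ℝ) : ℂ)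
  rw [← Lemma171.frakAC_eq χ hχ1 hχ2, Lemma171.frakAC]
  field_simp


/-- `ϱ_j(qʳ) = 1 − q^{β_j}` for a prime `q` and `r ≥ 1` (`μ(qⁱ) = 0` for `i ≥ 2`).
[cite: Zhang2022LandauSiegel, App. B p.107] -/
theorem varrhoJ_prime_pow (c' : ℝ) (D j : ℕ) {q r : ℕ} (hq : q.Prime) (hr : 1 ≤ r) :
    varrhoJ c' D j (q ^ r) = 1 - (q : ℂ) ^ Skeleton.betaJ c' D j := by
  unfold varrhoJ
  rw [Nat.sum_divisors_prime_pow hq]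
  induction r, hr using Nat.le_induction with
  | base =>
      simp [Finset.sum_range_succ, ArithmeticFunction.moebius_apply_prime hq]
      ring
  | succ r hr ih =>
      rw [Finset.sum_range_succ, ih, ArithmeticFunction.moebius_apply_prime_pow hq (by omega),
        if_neg (by omega)]
      simp

/-- The shift `β_j = b·i` with `|b| ≤ 3α(1 + 5|c′|α𝓛)` (from (2.13), `α, 𝓛 ≥ 0`).
[cite: Zhang2022LandauSiegel, §2 (2.13)] -/
theorem betaJ_bound (c' : ℝ) (D j : ℕ) (hα : 0 ≤ Skeleton.alpha D) (hℓ : 0 ≤ Skeleton.ell D) :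
    ∃ b : ℝ, Skeleton.betaJ c' D j = (b : ℂ) * I ∧
      |b| ≤ 3 * Skeleton.alpha D * (1 + 5 * |c'| * Skeleton.alpha D * Skeleton.ell D) := by
  have hαℓ : 0 ≤ |c'| * Skeleton.alpha D * Skeleton.ell D := by positivity
  have key : ∀ t : ℝ, |t| ≤ 5 * |c'| * Skeleton.alpha D * Skeleton.ell D →
      |1 - t| ≤ 1 + 5 * |c'| * Skeleton.alpha D * Skeleton.ell D ∧
      |1 + t| ≤ 1 + 5 * |c'| * Skeleton.alpha D * Skeleton.ell D := by
    intro t ht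
    constructor
    · calc |1 - t| ≤ |1| + |t| := abs_sub _ _
        _ ≤ _ := by rw [abs_one]; linarith
    · calc |1 + t| ≤ |1| + |t| := abs_add_le _ _
        _ ≤ _ := by rw [abs_one]; linarith
  have h5 : |5 * c' * Skeleton.alpha D * Skeleton.ell D| ≤
      5 * |c'| * Skeleton.alpha D * Skeleton.ell D := by
    rw [abs_mul, abs_mul, abs_mul, abs_of_nonneg hα, abs_of_nonneg hℓ,
      abs_of_nonneg (by norm_num : (0:ℝ) ≤ 5)]
  have h1 : |c' * Skeleton.alpha D * Skeleton.ell D| ≤ 5 * |c'| * Skeleton.alpha D * Skeleton.ell D := by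
    rw [abs_mul, abs_mul, abs_of_nonneg hα, abs_of_nonneg hℓ]; nlinarith
  unfold Skeleton.betaJ Skeleton.beta1 Skeleton.beta2 Skeleton.beta3
  split_ifs
  · refine ⟨Skeleton.alpha D * (1 - 5 * c' * Skeleton.alpha D * Skeleton.ell D),
      by push_cast; ring, ?_⟩
    rw [abs_mul, abs_of_nonneg hα]
    nlinarith [(key _ h5).1]
  · refine ⟨2 * Skeleton.alpha D * (1 + c' * Skeleton.alpha D * Skeleton.ell D),
      by push_cast; ring, ?_⟩
    rw [abs_mul, abs_mul, abs_of_nonneg hα, abs_of_nonneg (by norm_num : (0:ℝ) ≤ 2)]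
    nlinarith [(key _ h1).2]
  · refine ⟨3 * Skeleton.alpha D * (1 - c' * Skeleton.alpha D * Skeleton.ell D),
      by push_cast; ring, ?_⟩
    rw [abs_mul, abs_mul, abs_of_nonneg hα, abs_of_nonneg (by norm_num : (0:ℝ) ≤ 3)]
    nlinarith [(key _ h1).1]

/-- **`Z22:§B.u005` lead-in is a theorem**: `ϱ_j(qʳ) = ϱ_j(q)` (`r ≥ 1`) and `|ϱ_j(q)| ≤ C·α log q`
for every prime `q` (all `D ≥ 3`; `|1 − q^{ib}| ≤ |b| log q` and `|b_j| ≤ 3α(1 + 5|c′|α𝓛) ≤ 3α(1 + 5|c′|π)`).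
[cite: Zhang2022LandauSiegel, App. B p.107] -/
theorem stepB_u005a_holds (c' : ℝ) : StepB_u005a c' := by
  refine ⟨fun D j _ q r hq hr => ?_, ⟨3 * (1 + 5 * |c'| * Real.pi), 3, fun D _ _ hD _ _ => ?_⟩⟩
  · have h1 := varrhoJ_prime_pow c' D j hq (le_refl 1)
    rw [pow_one] at h1
    rw [varrhoJ_prime_pow c' D j hq hr, h1]
  · intro j _ q hq _
    have hℓ1 : 1 < Skeleton.ell D := Skeleton.one_lt_ell hD
    have hℓ : 0 ≤ Skeleton.ell D := by linarith
    have hαdef : Skeleton.alpha D = Real.pi / Skeleton.ell D ^ 9 := by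
      rw [Skeleton.alpha, Skeleton.bigP, Real.log_exp]
    have hα : 0 ≤ Skeleton.alpha D := by rw [hαdef]; positivity
    have hαℓ : Skeleton.alpha D * Skeleton.ell D ≤ Real.pi := by
      rw [hαdef, div_mul_eq_mul_div, div_le_iff₀ (by positivity)]
      have h8 : (1 : ℝ) ≤ Skeleton.ell D ^ 8 := one_le_pow₀ hℓ1.le
      have h9 : Skeleton.ell D ≤ Skeleton.ell D ^ 9 := by
        calc Skeleton.ell D = Skeleton.ell D * 1 := (mul_one _).symm
          _ ≤ Skeleton.ell D * Skeleton.ell D ^ 8 := mul_le_mul_of_nonneg_left h8 hℓ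
          _ = Skeleton.ell D ^ 9 := by ring
      exact mul_le_mul_of_nonneg_left h9 Real.pi_pos.le
    obtain ⟨b, hb, hbb⟩ := betaJ_bound c' D j hα hℓ
    have hq0 : 0 < q := hq.pos
    have hlog : 0 ≤ Real.log q := Real.log_nonneg (by exact_mod_cast hq.one_lt.le)
    -- `ϱ_j(q) = 1 − q^{ib}` and `q^{ib} = powI (−b) q`
    have h1 := varrhoJ_prime_pow c' D j hq (le_refl 1)
    rw [pow_one] at h1
    have hpow : (q : ℂ) ^ Skeleton.betaJ c' D j = MeanSquareMajorant.powI (-b) q := by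
      rw [MeanSquareMajorant.powI_apply_of_ne_zero _ hq0.ne', hb]
      push_cast
      ring_nf
    rw [h1, hpow, norm_sub_rev]
    calc ‖MeanSquareMajorant.powI (-b) q - 1‖ ≤ |(-b)| * Real.log q :=
          MeanSquareMajorant.norm_powI_sub_one_le (-b) hq0
      _ = |b| * Real.log q := by rw [abs_neg]
      _ ≤ 3 * Skeleton.alpha D * (1 + 5 * |c'| * Skeleton.alpha D * Skeleton.ell D) * Real.log q := by
          gcongr
      _ ≤ 3 * (1 + 5 * |c'| * Real.pi) * Skeleton.alpha D * Real.log q := by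
          have : Skeleton.alpha D * (1 + 5 * |c'| * Skeleton.alpha D * Skeleton.ell D) ≤
              (1 + 5 * |c'| * Real.pi) * Skeleton.alpha D := by
            have habs : 0 ≤ |c'| := abs_nonneg _
            nlinarith [mul_le_mul_of_nonneg_left hαℓ (mul_nonneg habs hα)]
          nlinarith

variable (c' : ℝ) in
/-- `StepB_u005a` — `_holds` alias of `stepB_u005a_holds` above under the fact's exact name, stated under the
prover's own binders as section variables (appended 2026-08-28, D-0026 bookkeeping: the proof term is the
existing theorem of this file; no statement, definition or attribute is edited; no new named fact; the
ledger's debt table listed the fact unproved). [cite: Zhang2022LandauSiegel, App. B p.107] -/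
theorem _root_.Literature.NumberTheory.LFunctions.Zhang2022.Typed.AppendixB.StepB_u005a_holds :
    _root_.Literature.NumberTheory.LFunctions.Zhang2022.Typed.AppendixB.StepB_u005a c' :=
  _root_.Literature.NumberTheory.LFunctions.Zhang2022.Typed.AppendixB.stepB_u005a_holds (c' := c')


/-- **`Z22:§B.u008` is a theorem**: Perron's formula for the weight `ϰ₂`,
`ϰ₂(m) = (1/2πi)∫_{(1)} (P₂/m)ˢ/((log P₂)(s − β₇)²) ds` (`P₂ > 1`, `m ≥ 1`): substituting
`s = β₇ + w` (`β₇ = 5iα/2` purely imaginary, so the line `Re s = 1` is `Re w = 1`),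
`(P₂/m)^{β₇}(log P₂)⁻¹ · (1/2πi)∫_{(1)} yʷ w⁻² dw` with `y = P₂/m`, and `(1/2πi)∫_{(1)} yʷw⁻² dw = log y`
for `y ≥ 1`, `0` for `y ≤ 1` (the tree's `integral_perronPow_vertical`, GPY (6.6) with `m = 1`).
[cite: Zhang2022LandauSiegel, App. B p.107] -/
theorem stepB_u008_holds : StepB_u008 := by
  intro D hP2 m hm
  have hP2pos : 0 < Skeleton.P2 D := by linarith
  have hlogP2 : 0 < Real.log (Skeleton.P2 D) := Real.log_pos hP2
  have hm0 : (0 : ℝ) < m := by exact_mod_cast hm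
  set y : ℝ := Skeleton.P2 D / m with hy
  have hy0 : 0 < y := div_pos hP2pos hm0
  have hy' : (y : ℂ) ≠ 0 := by exact_mod_cast hy0.ne'
  set b : ℝ := 5 * Skeleton.alpha D / 2 with hb
  have hβ : Skeleton.beta7 D = (b : ℂ) * I := by
    rw [Skeleton.beta7, hb]; push_cast; ring
  -- the integrand on the line `Re s = 1`, recentred at `β₇`
  set g : ℝ → ℂ := fun u => Literature.Analysis.Complex.perronPow y 1 (((1 : ℝ) : ℂ) + (u : ℂ) * I)
    with hg
  have hF : ∀ t : ℝ, kerB (Skeleton.P2 D) (Skeleton.beta7 D) m (((1 : ℝ) : ℂ) + (t : ℂ) * I) =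
      ((y : ℂ) ^ Skeleton.beta7 D / (Real.log (Skeleton.P2 D) : ℂ)) * g (t - b) := by
    intro t
    simp only [hg, kerB, Literature.Analysis.Complex.perronPow]
    have hsplit : ((1 : ℝ) : ℂ) + (t : ℂ) * I =
        Skeleton.beta7 D + (((1 : ℝ) : ℂ) + ((t - b : ℝ) : ℂ) * I) := by
      rw [hβ]; push_cast; ring
    rw [hsplit, Complex.cpow_add _ _ hy', add_sub_cancel_left]
    generalize (((1 : ℝ) : ℂ) + ((t - b : ℝ) : ℂ) * I) = w
    ring
  have hvline : vline 1 (kerB (Skeleton.P2 D) (Skeleton.beta7 D) m) =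
      (1 / (2 * Real.pi) : ℂ) * (((y : ℂ) ^ Skeleton.beta7 D / (Real.log (Skeleton.P2 D) : ℂ)) *
        ∫ t : ℝ, g t) := by
    rw [vline]
    congr 1
    simp_rw [hF]
    rw [MeasureTheory.integral_const_mul, MeasureTheory.integral_sub_right_eq_self g b]
  have hperron : ∫ t : ℝ, g t =
      if 1 ≤ y then 2 * Real.pi * (((Real.log y : ℝ) : ℂ) ^ 1 / ((1 : ℕ).factorial : ℂ)) else 0 :=
    Literature.Analysis.Complex.integral_perronPow_vertical hy0 one_pos le_rfl
  rw [hvline, hperron]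
  unfold Skeleton.vk2
  rw [← hy]
  have hπ : (Real.pi : ℂ) ≠ 0 := by exact_mod_cast Real.pi_ne_zero
  have hlog' : (Real.log (Skeleton.P2 D) : ℂ) ≠ 0 := by exact_mod_cast hlogP2.ne'
  by_cases hlt : (m : ℝ) < Skeleton.P2 D
  · -- `y > 1`
    have hy1 : 1 < y := by rw [hy, lt_div_iff₀ hm0]; linarith
    rw [if_pos hlt, if_pos hy1.le]
    have hlogy : Real.log y = Real.log (Skeleton.P2 D) - Real.log m := by
      rw [hy, Real.log_div hP2pos.ne' hm0.ne']
    rw [hlogy]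
    push_cast
    field_simp
    ring
  · rw [if_neg hlt]
    push Not at hlt
    rcases hlt.eq_or_lt with heq | hgt
    · -- `y = 1`: `log y = 0`
      have hy1 : y = 1 := by rw [hy, ← heq, div_self hP2pos.ne']
      rw [if_pos hy1.ge, hy1, Real.log_one]
      simp
    · -- `y < 1`
      have hy1 : ¬ 1 ≤ y := by
        rw [not_le, hy, div_lt_one hm0]; exact hgt
      rw [if_neg hy1]
      simp

/-- `Σ_n ν(n)² n^{−s}` converges absolutely for `re s > 1` (divisor bound `d(n) ≤ C n^{ε}`; the region of
Ramanujan's identity (1.2.10)). [cite: Titchmarsh1986, (1.2.10)] -/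
theorem LSeriesSummable_nu_sq {D : ℕ} [NeZero D] (χ : DirichletCharacter ℂ D) {s : ℂ}
    (hs : 1 < s.re) : LSeriesSummable (fun n => Skeleton.nu χ n ^ 2) s := by
  obtain ⟨C, hC1, hC⟩ :=
    Literature.NumberTheory.Sieve.exists_card_divisors_le_mul_rpow' (ε := (s.re - 1) / 4)
      (by linarith)
  have hmaj : Summable (fun n : ℕ => C ^ 2 * (n : ℝ) ^ (-((s.re + 1) / 2))) := by
    refine (Real.summable_nat_rpow.mpr ?_).mul_left _
    linarith
  refine Summable.of_norm (hmaj.of_nonneg_of_le (fun _ => norm_nonneg _) fun n => ?_)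
  rcases eq_or_ne n 0 with rfl | hn
  · simp [Real.zero_rpow (by linarith : -((s.re + 1) / 2) ≠ 0)]
  · have hn' : 0 < (n : ℝ) := by positivity
    rw [LSeries.term_of_ne_zero hn, norm_div, norm_pow,
      Complex.norm_natCast_cpow_of_pos (Nat.pos_of_ne_zero hn)]
    have hd : ‖Skeleton.nu χ n‖ ≤ C * (n : ℝ) ^ ((s.re - 1) / 4) :=
      (Literature.NumberTheory.LFunctions.norm_divisorSumChar_le χ n).trans (hC n)
    rw [div_eq_mul_inv, ← Real.rpow_neg hn'.le]
    calc ‖Skeleton.nu χ n‖ ^ 2 * (n : ℝ) ^ (-s.re)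
        ≤ (C * (n : ℝ) ^ ((s.re - 1) / 4)) ^ 2 * (n : ℝ) ^ (-s.re) := by
          gcongr
      _ = C ^ 2 * ((n : ℝ) ^ ((s.re - 1) / 4 * 2) * (n : ℝ) ^ (-s.re)) := by
          rw [mul_pow, Real.rpow_mul hn'.le]; norm_cast; ring
      _ = C ^ 2 * (n : ℝ) ^ (-((s.re + 1) / 2)) := by
          rw [← Real.rpow_add hn']; congr 1; ring_nf

/-- **`Z22:§B.u017` is a theorem**: the Mellin form of the smoothed sum,
`Σ_n ν(n)²/n · g(T/n) = (1/2πi)∫_{(1)} (Σ_n ν(n)²/n^{1+s}) Tˢω₁(s)/s ds` (the tree's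
`GaussWeight.integral_LSeries_mul_kernel`: `∑` and `∫` interchanged by absolute convergence, (4.1)).
[cite: Zhang2022LandauSiegel, App. B p.108] -/
theorem stepB_u017_holds : StepB_u017 := by
  refine ⟨3, fun D _ χ hD _ _ => ?_⟩
  dsimp only
  have hℓ : 0 < Skeleton.ell D := by linarith [Skeleton.one_lt_ell hD]
  have hΛ : 0 < Skeleton.ell D ^ 30 := pow_pos hℓ 30
  have hT : 0 < Skeleton.bigT D := Real.exp_pos _
  have hs : LSeriesSummable (fun n => Skeleton.nu χ n ^ 2) (1 + (1 : ℝ)) :=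
    LSeriesSummable_nu_sq χ (by simp)
  have key := GaussWeight.integral_LSeries_mul_kernel hΛ one_pos hT hs
  -- the right side of `key` is the printed left side
  have hterm : ∀ n : ℕ, LSeries.term (fun n => Skeleton.nu χ n ^ 2) 1 n *
      (Skeleton.gW D (Skeleton.bigT D / n) : ℂ) =
      Skeleton.nu χ n ^ 2 / (n : ℂ) * (Skeleton.gW D (Skeleton.bigT D / n) : ℂ) := by
    intro n
    rcases eq_or_ne n 0 with rfl | hn
    · simp [Skeleton.nu]
    · rw [LSeries.term_of_ne_zero hn, Complex.cpow_one]
  simp_rw [Skeleton.gW] at hterm ⊢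
  simp_rw [hterm] at key
  rw [← key, vline]
  congr 1


/-- `P^{(a·β)} = (P^a)^β` for a real `a` and `P > 0` (real base, real first exponent: no branch issue).
[folklore] -/
private theorem cpow_ofReal_mul {P : ℝ} (hP : 0 < P) (a : ℝ) (β : ℂ) :
    (P : ℂ) ^ ((a : ℂ) * β) = ((P ^ a : ℝ) : ℂ) ^ β := by
  rw [Complex.ofReal_cpow hP.le, Complex.cpow_mul]
  · rw [← Complex.ofReal_log hP.le, ← Complex.ofReal_mul, Complex.ofReal_im]
    exact neg_lt_zero.mpr Real.pi_pos
  · rw [← Complex.ofReal_log hP.le, ← Complex.ofReal_mul, Complex.ofReal_im]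
    exact Real.pi_pos.le

/-- The pointwise identity behind `Z22:§B.u014`: on `s = β + w`,
`P^{βc₀} P^{c_z s} ω₁(s−β)/(yˢ(s−β)) = (P^{0.504}/y)^β · (P^{c_z}/y)ʷ ω₁(w)/w` when `c₀ + c_z = 0.504`.
[cite: Zhang2022LandauSiegel, App. B p.108] -/
private theorem mellin_term_eq {P y Λ c₀ cz : ℝ} (hP : 0 < P) (hy : 0 < y) (hc : c₀ + cz = 0.504)
    (β w : ℂ) :
    (P : ℂ) ^ (β * (c₀ : ℂ)) * (P : ℂ) ^ ((cz : ℂ) * (β + w)) *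
        GaussWeight.omega1 Λ ((β + w) - β) / ((y : ℂ) ^ (β + w) * ((β + w) - β)) =
      ((P ^ (0.504 : ℝ) / y : ℝ) : ℂ) ^ β *
        (((P ^ cz / y : ℝ) : ℂ) ^ w * GaussWeight.omega1 Λ w / w) := by
  have hP' : (P : ℂ) ≠ 0 := by exact_mod_cast hP.ne'
  have hy' : (y : ℂ) ≠ 0 := by exact_mod_cast hy.ne'
  have hPc : 0 < P ^ cz := Real.rpow_pos_of_pos hP cz
  have hP5 : 0 < P ^ (0.504 : ℝ) := Real.rpow_pos_of_pos hP _
  rw [add_sub_cancel_left, GaussWeight.div_cpow_line hP5 hy, GaussWeight.div_cpow_line hPc hy,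
    Complex.cpow_add _ _ hy', mul_add, Complex.cpow_add _ _ hP']
  -- collect the `β`-powers of `P`: `β c₀ + c_z β = (0.504) β`
  have hexp : (P : ℂ) ^ (β * (c₀ : ℂ)) * (P : ℂ) ^ ((cz : ℂ) * β) =
      ((P ^ (0.504 : ℝ) : ℝ) : ℂ) ^ β := by
    rw [← Complex.cpow_add _ _ hP', ← cpow_ofReal_mul hP]
    congr 1
    rw [← hc]
    push_cast
    ring
  have hz : (P : ℂ) ^ ((cz : ℂ) * w) = ((P ^ cz : ℝ) : ℂ) ^ w := cpow_ofReal_mul hP cz w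
  rw [hz]
  have hyβ : (y : ℂ) ^ β ≠ 0 := by
    rw [Ne, Complex.cpow_eq_zero_iff]; exact fun h => hy' h.1
  have hyw : (y : ℂ) ^ w ≠ 0 := by
    rw [Ne, Complex.cpow_eq_zero_iff]; exact fun h => hy' h.1
  calc (P : ℂ) ^ (β * (c₀ : ℂ)) * ((P : ℂ) ^ ((cz : ℂ) * β) * ((P ^ cz : ℝ) : ℂ) ^ w) *
        GaussWeight.omega1 Λ w / ((y : ℂ) ^ β * (y : ℂ) ^ w * w)
      = ((P : ℂ) ^ (β * (c₀ : ℂ)) * (P : ℂ) ^ ((cz : ℂ) * β)) *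
          (((P ^ cz : ℝ) : ℂ) ^ w * GaussWeight.omega1 Λ w / ((y : ℂ) ^ β * (y : ℂ) ^ w * w)) := by
        ring
    _ = _ := by rw [hexp]; field_simp

/-- **`Z22:§B.u014` is a theorem**: the change of variable `w = s − β₆` in the Mellin form (4.1) of `g`,
`(P₁/y)^{β₆}{g(P^z/y) − g(P^{0.5}/y)} = (1/2πi)∫_{(1)} (P^{β₆(0.504−z)}P^{zs} − P^{0.004β₆}P^{0.5s})
ω₁(s−β₆) ds/(yˢ(s−β₆))` (`β₆ = 3iα/2` purely imaginary, so the line is unchanged; the tree's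
`GaussWeight.integral_kernel'`, translation invariance of `∫_ℝ`). [cite: Zhang2022LandauSiegel, App. B p.108] -/
theorem stepB_u014_holds : StepB_u014 := by
  refine ⟨3, fun D _ _ hD _ _ => ?_⟩
  intro y hy z hz
  have hℓ : 0 < Skeleton.ell D := by linarith [Skeleton.one_lt_ell hD]
  have hΛ : 0 < Skeleton.ell D ^ 30 := pow_pos hℓ 30
  have hP : 0 < Skeleton.bigP D := Real.exp_pos _
  set Λ : ℝ := Skeleton.ell D ^ 30 with hΛdef
  set P : ℝ := Skeleton.bigP D with hPdef
  set b : ℝ := 3 * Skeleton.alpha D / 2 with hb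
  have hβ : Skeleton.beta6 D = (b : ℂ) * I := by
    rw [Skeleton.beta6, hb]; push_cast; ring
  set β : ℂ := Skeleton.beta6 D with hβdef
  -- the two translated kernels
  set A : ℝ → ℝ → ℂ := fun cz t =>
    ((P ^ (0.504 : ℝ) / y : ℝ) : ℂ) ^ β * GaussWeight.kernel Λ 1 (P ^ cz / y) (t - b) with hA
  have hline : ∀ t : ℝ, ((1 : ℝ) : ℂ) + (t : ℂ) * I = β + (((1 : ℝ) : ℂ) + ((t - b : ℝ) : ℂ) * I) := by
    intro t; rw [hβ]; push_cast; ring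
  have hpt : ∀ t : ℝ,
      mellinB14 D z (((1 : ℝ) : ℂ) + (t : ℂ) * I) * GaussWeight.omega1 Λ ((((1 : ℝ) : ℂ) + (t : ℂ) * I) - β) /
        ((y : ℂ) ^ (((1 : ℝ) : ℂ) + (t : ℂ) * I) * ((((1 : ℝ) : ℂ) + (t : ℂ) * I) - β)) =
      A z t - A 0.5 t := by
    intro t
    simp only [hA, GaussWeight.kernel, mellinB14, ← hPdef, ← hβdef]
    rw [sub_mul, sub_div, hline t,
      mellin_term_eq hP hy (by ring : (0.504 - z) + z = 0.504) β _,
      mul_comm (((0.004 : ℝ) : ℂ)) β,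
      mellin_term_eq hP hy (by norm_num : (0.004 : ℝ) + 0.5 = 0.504) β _]
  have hint : ∀ cz : ℝ, Integrable (A cz) ∧
      ∫ t : ℝ, A cz t = ((P ^ (0.504 : ℝ) / y : ℝ) : ℂ) ^ β * (2 * π * (Skeleton.gW D (P ^ cz / y) : ℂ)) := by
    intro cz
    have hX : 0 < P ^ cz / y := div_pos (Real.rpow_pos_of_pos hP cz) hy
    constructor
    · exact ((GaussWeight.integrable_kernel hΛ one_pos hX).comp_sub_right b).const_mul _
    · simp only [hA]
      rw [MeasureTheory.integral_const_mul,
        MeasureTheory.integral_sub_right_eq_self (GaussWeight.kernel Λ 1 (P ^ cz / y)) b,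
        GaussWeight.integral_kernel' hΛ one_pos hX, Skeleton.gW]
  rw [vline]
  simp_rw [hpt]
  rw [MeasureTheory.integral_sub (hint z).1 (hint 0.5).1, (hint z).2, (hint 0.5).2]
  have hπ : (π : ℂ) ≠ 0 := by exact_mod_cast Real.pi_ne_zero
  simp only [Skeleton.P1, ← hPdef]
  push_cast
  field_simp


/-- `P₂ > 1` for `D ≥ 8` (`log P₂ = 0.5𝓛⁹ − 10𝓛^{1.1} > 0` once `𝓛 ≥ 2`). [cite: Zhang2022LandauSiegel, §2 (2.21)] -/
theorem one_lt_P2 {D : ℕ} (hD : 8 ≤ D) : 1 < Skeleton.P2 D := by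
  have hℓ2 : 2 ≤ Skeleton.ell D := by
    have h8 : (8 : ℝ) ≤ D := by exact_mod_cast hD
    have he : Real.exp 2 ≤ 8 := by
      have h1 := Real.exp_one_lt_d9
      have : Real.exp 2 = Real.exp 1 * Real.exp 1 := by rw [← Real.exp_add]; norm_num
      rw [this]; nlinarith [Real.exp_pos 1]
    calc (2 : ℝ) = Real.log (Real.exp 2) := (Real.log_exp 2).symm
      _ ≤ Real.log 8 := Real.log_le_log (Real.exp_pos 2) he
      _ ≤ Skeleton.ell D := Real.log_le_log (by norm_num) h8
  have hℓ1 : 1 ≤ Skeleton.ell D := by linarith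
  have hℓ0 : 0 < Skeleton.ell D := by linarith
  -- `10 𝓛^{1.1} < 0.5 𝓛⁹`
  have h11 : Skeleton.ell D ^ (1.1 : ℝ) ≤ Skeleton.ell D ^ 2 := by
    calc Skeleton.ell D ^ (1.1 : ℝ) ≤ Skeleton.ell D ^ (2 : ℝ) :=
          Real.rpow_le_rpow_of_exponent_le hℓ1 (by norm_num)
      _ = Skeleton.ell D ^ 2 := by norm_cast
  have h7 : (128 : ℝ) ≤ Skeleton.ell D ^ 7 := by
    calc (128 : ℝ) = 2 ^ 7 := by norm_num
      _ ≤ Skeleton.ell D ^ 7 := pow_le_pow_left₀ (by norm_num) hℓ2 7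
  have hkey : 10 * Skeleton.ell D ^ (1.1 : ℝ) < 0.5 * Skeleton.ell D ^ 9 := by
    have hsq : 0 < Skeleton.ell D ^ 2 := by positivity
    calc 10 * Skeleton.ell D ^ (1.1 : ℝ) ≤ 10 * Skeleton.ell D ^ 2 := by linarith
      _ < 64 * Skeleton.ell D ^ 2 := by linarith
      _ = 0.5 * (128 * Skeleton.ell D ^ 2) := by ring
      _ ≤ 0.5 * (Skeleton.ell D ^ 7 * Skeleton.ell D ^ 2) := by gcongr
      _ = 0.5 * Skeleton.ell D ^ 9 := by ring
  unfold Skeleton.P2 Skeleton.bigP Skeleton.bigT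
  rw [← Real.exp_mul, ← Real.exp_nat_mul, lt_div_iff₀ (Real.exp_pos _), one_mul, Real.exp_lt_exp]
  push_cast
  linarith

/-- `ϱ_j(0) = 0` (junk value: `Nat.divisors 0 = ∅`). [folklore] -/
@[simp] private theorem varrhoJ_zero (c' : ℝ) (D j : ℕ) : varrhoJ c' D j 0 = 0 := by
  simp [varrhoJ]

/-- `|ϱ_j(n)| ≤ τ₂(n)` (`|μ(d)| ≤ 1`, `|d^{β_j}| = 1`). [cite: Zhang2022LandauSiegel, App. B p.106] -/
theorem norm_varrhoJ_le (c' : ℝ) (D j n : ℕ) : ‖varrhoJ c' D j n‖ ≤ (n.divisors.card : ℝ) := by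
  unfold varrhoJ
  calc ‖∑ d ∈ n.divisors, (ArithmeticFunction.moebius d : ℂ) * (d : ℂ) ^ Skeleton.betaJ c' D j‖
      ≤ ∑ d ∈ n.divisors, ‖(ArithmeticFunction.moebius d : ℂ) * (d : ℂ) ^ Skeleton.betaJ c' D j‖ :=
        norm_sum_le _ _
    _ ≤ ∑ d ∈ n.divisors, (1 : ℝ) := by
        refine Finset.sum_le_sum fun d hd => ?_
        have hd0 : 0 < d := Nat.pos_of_mem_divisors hd
        rw [norm_mul, Complex.norm_natCast_cpow_of_pos hd0, betaJ_re, Real.rpow_zero, mul_one,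
          Complex.norm_intCast]
        exact_mod_cast ArithmeticFunction.abs_moebius_le_one
    _ = (n.divisors.card : ℝ) := by simp

/-- The kernel of `ϰ₂` on the line `Re s = 1`: absolutely integrable with
`∫ |(P₂/m)ˢ/((log P₂)(s−β₇)²)| dt = π (P₂/m)/log P₂`, and `∫ = 2π·ϰ₂(m)` (`StepB_u008`).
[cite: Zhang2022LandauSiegel, App. B p.107] -/
theorem kerB_line (D : ℕ) (hP2 : 1 < Skeleton.P2 D) {m : ℕ} (hm : 1 ≤ m) :
    Integrable (fun t : ℝ => kerB (Skeleton.P2 D) (Skeleton.beta7 D) m (((1 : ℝ) : ℂ) + (t : ℂ) * I)) ∧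
    (∫ t : ℝ, ‖kerB (Skeleton.P2 D) (Skeleton.beta7 D) m (((1 : ℝ) : ℂ) + (t : ℂ) * I)‖) =
      Skeleton.P2 D / m / Real.log (Skeleton.P2 D) * π ∧
    (∫ t : ℝ, kerB (Skeleton.P2 D) (Skeleton.beta7 D) m (((1 : ℝ) : ℂ) + (t : ℂ) * I)) =
      2 * π * Skeleton.vk2 D m := by
  have hP2pos : 0 < Skeleton.P2 D := by linarith
  have hlogP2 : 0 < Real.log (Skeleton.P2 D) := Real.log_pos hP2
  have hm0 : (0 : ℝ) < m := by exact_mod_cast hm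
  set y : ℝ := Skeleton.P2 D / m with hy
  have hy0 : 0 < y := div_pos hP2pos hm0
  have hy' : (y : ℂ) ≠ 0 := by exact_mod_cast hy0.ne'
  set b : ℝ := 5 * Skeleton.alpha D / 2 with hb
  have hβ : Skeleton.beta7 D = (b : ℂ) * I := by
    rw [Skeleton.beta7, hb]; push_cast; ring
  set g : ℝ → ℂ := fun u => Literature.Analysis.Complex.perronPow y 1 (((1 : ℝ) : ℂ) + (u : ℂ) * I)
    with hg
  have hF : ∀ t : ℝ, kerB (Skeleton.P2 D) (Skeleton.beta7 D) m (((1 : ℝ) : ℂ) + (t : ℂ) * I) =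
      ((y : ℂ) ^ Skeleton.beta7 D / (Real.log (Skeleton.P2 D) : ℂ)) * g (t - b) := by
    intro t
    simp only [hg, kerB, Literature.Analysis.Complex.perronPow]
    have hsplit : ((1 : ℝ) : ℂ) + (t : ℂ) * I =
        Skeleton.beta7 D + (((1 : ℝ) : ℂ) + ((t - b : ℝ) : ℂ) * I) := by
      rw [hβ]; push_cast; ring
    rw [hsplit, Complex.cpow_add _ _ hy', add_sub_cancel_left]
    generalize (((1 : ℝ) : ℂ) + ((t - b : ℝ) : ℂ) * I) = w
    ring
  have hfun : (fun t : ℝ => kerB (Skeleton.P2 D) (Skeleton.beta7 D) m (((1 : ℝ) : ℂ) + (t : ℂ) * I)) =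
      fun t => ((y : ℂ) ^ Skeleton.beta7 D / (Real.log (Skeleton.P2 D) : ℂ)) * g (t - b) :=
    funext hF
  have hgi : Integrable g :=
    Literature.Analysis.Complex.integrable_perronPow_vertical hy0 le_rfl one_ne_zero
  refine ⟨?_, ?_, ?_⟩
  · rw [hfun]; exact (hgi.comp_sub_right b).const_mul _
  · -- the norm: `‖kerB‖ = (y/log P₂)(1 + (t−b)²)⁻¹`
    have hnorm : ∀ t : ℝ, ‖kerB (Skeleton.P2 D) (Skeleton.beta7 D) m (((1 : ℝ) : ℂ) + (t : ℂ) * I)‖ =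
        y / Real.log (Skeleton.P2 D) * (1 + (t - b) ^ 2)⁻¹ := by
      intro t
      simp only [kerB, ← hy]
      have hsub : ((1 : ℝ) : ℂ) + (t : ℂ) * I - Skeleton.beta7 D = ((1 : ℝ) : ℂ) + ((t - b : ℝ) : ℂ) * I := by
        rw [hβ]; push_cast; ring
      have hre : (((1 : ℝ) : ℂ) + (t : ℂ) * I).re = 1 := by simp
      rw [norm_div, norm_mul, norm_pow, hsub, Complex.norm_cpow_eq_rpow_re_of_pos hy0, hre,
        Real.rpow_one, Complex.norm_real, Real.norm_of_nonneg hlogP2.le, Complex.sq_norm,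
        Complex.normSq_add_mul_I, one_pow, div_mul_eq_div_div, div_eq_mul_inv]
    simp_rw [hnorm]
    rw [MeasureTheory.integral_const_mul,
      MeasureTheory.integral_sub_right_eq_self (fun t : ℝ => (1 + t ^ 2)⁻¹) b,
      integral_univ_inv_one_add_sq, hy]
  · have h8 := stepB_u008_holds D hP2 m hm
    rw [vline] at h8
    have hπ : (π : ℂ) ≠ 0 := by exact_mod_cast Real.pi_ne_zero
    rw [h8, ← mul_assoc, show (2 * (π : ℂ)) * (1 / (2 * π)) = 1 by field_simp, one_mul]

/-- **`Z22:§B.u009` is a theorem**: "it follows that `Σ_l ϰ₂(l₁l)ϱ_j(l)/l = (1/2πi)∫_{(1)} ζ(1+s)/ζ(1+s−β_j)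
(P₂/l₁)ˢ/((log P₂)(s−β₇)²) ds`" — from `StepB_u007` at `1+s`, Perron termwise (`StepB_u008`) and the
interchange of `Σ_l` and `∫` by absolute convergence (`Σ_l |ϱ_j(l)| l⁻² < ∞`); for `D ≥ 8` (so that
`P₂ > 1`). [cite: Zhang2022LandauSiegel, App. B p.107] -/
theorem stepB_u009_holds (c' : ℝ) : StepB_u009 c' := by
  refine ⟨8, fun D _ _ hD _ _ => ?_⟩
  intro j hj l₁ hl₁
  have hP2 : 1 < Skeleton.P2 D := one_lt_P2 hD
  have hP2pos : 0 < Skeleton.P2 D := by linarith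
  have hlogP2 : 0 < Real.log (Skeleton.P2 D) := Real.log_pos hP2
  have hl₁0 : (0 : ℝ) < l₁ := by exact_mod_cast hl₁
  have hP1 : 1 ≤ Skeleton.bigP D := by
    rw [Skeleton.bigP]; exact Real.one_le_exp (pow_nonneg (Real.log_natCast_nonneg D) 9)
  have hP2P : Skeleton.P2 D ≤ Skeleton.bigP D := by
    have hT : 1 ≤ Skeleton.bigT D := by
      rw [Skeleton.bigT]
      exact Real.one_le_exp (Real.rpow_nonneg (Real.log_natCast_nonneg D) _)
    have hT10 : 1 ≤ Skeleton.bigT D ^ 10 := one_le_pow₀ hT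
    calc Skeleton.P2 D = Skeleton.bigP D ^ (0.5 : ℝ) / Skeleton.bigT D ^ 10 := rfl
      _ ≤ Skeleton.bigP D ^ (0.5 : ℝ) := div_le_self (by positivity) hT10
      _ ≤ Skeleton.bigP D ^ (1 : ℝ) := Real.rpow_le_rpow_of_exponent_le hP1 (by norm_num)
      _ = Skeleton.bigP D := Real.rpow_one _
  -- the summands
  set G : ℕ → ℝ → ℂ := fun l t =>
    varrhoJ c' D j l / (l : ℂ) * kerB (Skeleton.P2 D) (Skeleton.beta7 D) (l₁ * l) (((1 : ℝ) : ℂ) + (t : ℂ) * I)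
    with hGdef
  -- Step A: the integrand is `Σ' l, G l t`
  have hA : ∀ t : ℝ, intB2 c' D j l₁ (((1 : ℝ) : ℂ) + (t : ℂ) * I) = ∑' l : ℕ, G l t := by
    intro t
    simp only [intB2, zetaRatio, hGdef]
    set s : ℂ := ((1 : ℝ) : ℂ) + (t : ℂ) * I with hsdef
    have hs2 : 1 < (1 + s).re := by simp [hsdef]
    have h7 := stepB_u007_holds c' D j hj (1 + s) hs2
    rw [← h7, LSeries, ← tsum_mul_right]
    refine tsum_congr fun l => ?_
    rcases eq_or_ne l 0 with rfl | hl
    · simp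
    have hl0 : (0 : ℝ) < l := by exact_mod_cast Nat.pos_of_ne_zero hl
    have hlc : (l : ℂ) ≠ 0 := by exact_mod_cast hl
    rw [LSeries.term_of_ne_zero hl, kerB, kerB, Complex.cpow_add _ _ hlc, Complex.cpow_one,
      show (Skeleton.P2 D / (l₁ * l : ℕ) : ℝ) = Skeleton.P2 D / l₁ / l by push_cast; rw [div_div],
      GaussWeight.div_cpow_line (div_pos hP2pos hl₁0) hl0, Complex.ofReal_natCast]
    ring
  -- Step B/C: termwise integrability, norms and values
  have hker : ∀ l : ℕ, 1 ≤ l →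
      Integrable (G l) ∧
      (∫ t : ℝ, ‖G l t‖) = ‖varrhoJ c' D j l‖ / l * (Skeleton.P2 D / (l₁ * l : ℕ) / Real.log (Skeleton.P2 D) * π) ∧
      (∫ t : ℝ, G l t) = varrhoJ c' D j l / (l : ℂ) * (2 * π * Skeleton.vk2 D (l₁ * l)) := by
    intro l hl
    obtain ⟨hi, hn, hv⟩ := kerB_line D hP2 (m := l₁ * l)
      (Nat.one_le_iff_ne_zero.mpr (mul_ne_zero (by omega) (by omega)))
    refine ⟨hi.const_mul _, ?_, ?_⟩
    · simp only [hGdef, norm_mul, MeasureTheory.integral_const_mul, hn, norm_div, Complex.norm_natCast]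
    · simp only [hGdef, MeasureTheory.integral_const_mul, hv]
  have hG0 : G 0 = fun _ => 0 := by funext t; simp [hGdef]
  have hint : ∀ l : ℕ, Integrable (G l) := by
    intro l
    rcases Nat.eq_zero_or_pos l with rfl | hl
    · rw [hG0]; exact integrable_zero _ _ _
    · exact (hker l hl).1
  have hsum : Summable fun l : ℕ => ∫ t : ℝ, ‖G l t‖ := by
    obtain ⟨C, hC1, hC⟩ :=
      Literature.NumberTheory.Sieve.exists_card_divisors_le_mul_rpow' (ε := (1 / 2 : ℝ)) (by norm_num)
    have hmaj : Summable (fun l : ℕ =>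
        (C * (Skeleton.P2 D / l₁ / Real.log (Skeleton.P2 D) * π)) * (l : ℝ) ^ (-(3 / 2 : ℝ))) := by
      refine (Real.summable_nat_rpow.mpr ?_).mul_left _
      norm_num
    refine hmaj.of_nonneg_of_le (fun l => integral_nonneg fun t => norm_nonneg _) fun l => ?_
    rcases Nat.eq_zero_or_pos l with rfl | hl
    · simp [hG0, Real.zero_rpow (by norm_num : -(3 / 2 : ℝ) ≠ 0)]
    rw [(hker l hl).2.1]
    have hl0 : (0 : ℝ) < l := by exact_mod_cast hl
    have hρ : ‖varrhoJ c' D j l‖ ≤ C * (l : ℝ) ^ (1 / 2 : ℝ) := (norm_varrhoJ_le c' D j l).trans (hC l)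
    have hK : 0 ≤ Skeleton.P2 D / l₁ / Real.log (Skeleton.P2 D) * π := by positivity
    calc ‖varrhoJ c' D j l‖ / l * (Skeleton.P2 D / (l₁ * l : ℕ) / Real.log (Skeleton.P2 D) * π)
        = ‖varrhoJ c' D j l‖ * ((Skeleton.P2 D / l₁ / Real.log (Skeleton.P2 D) * π) * ((l : ℝ) * l)⁻¹) := by
          push_cast
          field_simp
      _ ≤ (C * (l : ℝ) ^ (1 / 2 : ℝ)) * ((Skeleton.P2 D / l₁ / Real.log (Skeleton.P2 D) * π) * ((l : ℝ) * l)⁻¹) := by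
          gcongr
      _ = (C * (Skeleton.P2 D / l₁ / Real.log (Skeleton.P2 D) * π)) * ((l : ℝ) ^ (1 / 2 : ℝ) * ((l : ℝ) * l)⁻¹) := by
          ring
      _ = (C * (Skeleton.P2 D / l₁ / Real.log (Skeleton.P2 D) * π)) * (l : ℝ) ^ (-(3 / 2 : ℝ)) := by
          congr 1
          rw [show ((l : ℝ) * l)⁻¹ = (l : ℝ) ^ (-(2 : ℝ)) by
            rw [Real.rpow_neg hl0.le, Real.rpow_two, pow_two], ← Real.rpow_add hl0]
          norm_num
  -- Step D: assemble
  rw [vline]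
  simp_rw [hA]
  rw [← MeasureTheory.integral_tsum_of_summable_integral_norm hint hsum]
  have hval : ∀ l : ℕ, (∫ t : ℝ, G l t) = 2 * π * (Skeleton.vk2 D (l₁ * l) * varrhoJ c' D j l / (l : ℂ)) := by
    intro l
    rcases Nat.eq_zero_or_pos l with rfl | hl
    · simp [hG0]
    · rw [(hker l hl).2.2]; ring
  simp_rw [hval]
  rw [tsum_mul_left, ← mul_assoc]
  have hπ : (π : ℂ) ≠ 0 := by exact_mod_cast Real.pi_ne_zero
  have hone : (1 / (2 * (π : ℂ))) * (2 * π) = 1 := by field_simp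
  rw [hone, one_mul, vkSum]
  symm
  refine tsum_eq_sum fun l hl => ?_
  -- terms outside `1 ≤ l < P` vanish
  rcases Nat.eq_zero_or_pos l with rfl | hlpos
  · simp
  · have hlP : ⌈Skeleton.bigP D⌉₊ ≤ l := by
      by_contra h
      push Not at h
      exact hl (Finset.mem_Ico.mpr ⟨hlpos, h⟩)
    have hge : ¬ ((l₁ * l : ℕ) : ℝ) < Skeleton.P2 D := by
      push Not
      have hlreal : Skeleton.bigP D ≤ (l : ℝ) := le_trans (Nat.le_ceil _) (by exact_mod_cast hlP)
      calc Skeleton.P2 D ≤ Skeleton.bigP D := hP2P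
        _ ≤ l := hlreal
        _ ≤ ((l₁ * l : ℕ) : ℝ) := by
            push_cast; exact le_mul_of_one_le_left (by positivity) (by exact_mod_cast hl₁)
    rw [Skeleton.vk2, if_neg hge, zero_mul, zero_div]

variable (c' : ℝ) in
/-- `StepB_u009` — `_holds` alias of `stepB_u009_holds` above under the fact's exact name, stated under the
prover's own binders as section variables (appended 2026-08-28, D-0026 bookkeeping: the proof term is the
existing theorem of this file; no statement, definition or attribute is edited; no new named fact; the
ledger's debt table listed the fact unproved). [cite: Zhang2022LandauSiegel, App. B p.107] -/
theorem _root_.Literature.NumberTheory.LFunctions.Zhang2022.Typed.AppendixB.StepB_u009_holds :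
    _root_.Literature.NumberTheory.LFunctions.Zhang2022.Typed.AppendixB.StepB_u009 c' :=
  _root_.Literature.NumberTheory.LFunctions.Zhang2022.Typed.AppendixB.stepB_u009_holds (c' := c')

end Discharges

/-! ## The reading of record `α₁ := α·log T` (`SkeletonAlpha1`): the `O(α₁)` claims re-typed

RULING (skeleton owner, file `SkeletonAlpha1`: `Skeleton.alpha1 D = alpha D * log (bigT D)`, `= α𝓛^{1.1}` by
`Skeleton.log_bigT`; gap row G-L4t10-2 closed by it): the manuscript's undefined `α₁` (29 uses) is read
`α·log T`. The decls above keep the bank's earlier reading `α₁ := α𝓛` — they are the STRONGER claims and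
stay exactly as typed (other files import them); the variants below (suffix `R`) restate the eleven `O(α₁)`
claims of the proof of Lemma 15.1 with the bound `C·alpha1 D`, and each is implied by its banked form
(`…R_of`: `α𝓛 ≤ α₁` for `D ≥ 3`, `Skeleton.alpha_mul_ell_le_alpha1`). Under the `α𝓛` reading the
display `Z22:§B.u010` "`−β_j/(β₇² log P₂) = −8j/(25πi) + O(α₁)`" fails by a factor `𝓛^{0.1}`
(`log P₂ = 0.5𝓛⁹ − 10𝓛^{1.1}`, so the left side is `(8ji/25π)(1 + κ_jc′α𝓛)/(1 − 20𝓛^{−7.9})` EXACTLY,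
`resZero2_sub_main_eq`); in the reading of record it HOLDS and is proved below (`stepB_u010bR_holds`),
while the banked `StepB_u010b` is refuted for every `c′` (`not_StepB_u010b`, tested at large prime moduli
with the Legendre character). Every `def … : Prop` here is a CLAIM OF THE MANUSCRIPT, stated not asserted. -/

section ReadingR

variable (c' : ℝ)

/-- `StepB_u009r` in the reading of record `α₁ = α log T` (error `≤ C·alpha1 D`; same locator and claim
otherwise). CLAIM. [cite: Zhang2022LandauSiegel, App. B p.107] -/
def StepB_u009rR : Prop :=
  ∃ C : ℝ, Skeleton.ForAllLarge fun D _ _ =>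
    ∀ j ∈ ({1, 2, 3} : Finset ℕ), ∀ l₁ : ℕ, 1 ≤ l₁ → l₁ ∈ Skeleton.nset (Skeleton.frakq D) →
      (l₁ : ℝ) < Skeleton.bigT D →
        ‖vline 1 (intB2 c' D j l₁) -
            (2 * π * I)⁻¹ * (∮ s in C((0 : ℂ), 5 * Skeleton.alpha D), intB2 c' D j l₁ s)‖ ≤
          C * Skeleton.alpha1 D

/-- `StepB_u010b` in the reading of record `α₁ = α log T`: "`−β_j/(β₇² log P₂) = −8j/(25πi) + O(α₁)`"
with error `≤ C·alpha1 D`. CLAIM (PROVED below, `stepB_u010bR_holds`). [cite: Zhang2022LandauSiegel, App. B p.107] -/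
def StepB_u010bR : Prop :=
  ∃ C : ℝ, Skeleton.ForAllLarge fun D _ _ => ∀ j ∈ ({1, 2, 3} : Finset ℕ),
    ‖resZero2 c' D j - (-(8 * (j : ℂ) / (25 * π * I)))‖ ≤ C * Skeleton.alpha1 D

/-- `StepB_u011b` in the reading of record `α₁ = α log T` (error `≤ C·alpha1 D`). CLAIM.
[cite: Zhang2022LandauSiegel, App. B p.107] -/
def StepB_u011bR : Prop :=
  ∃ C : ℝ, Skeleton.ForAllLarge fun D _ _ =>
    ∀ j ∈ ({1, 2, 3} : Finset ℕ), ∀ l₁ : ℕ, 1 ≤ l₁ → l₁ ∈ Skeleton.nset (Skeleton.frakq D) →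
      (l₁ : ℝ) < Skeleton.bigT D →
        ‖resBeta2 c' D j l₁ -
            (1 - 2 * (j : ℂ) / 5 + 8 * (j : ℂ) / (25 * π * I)) * cexp (5 * π * I / 4)‖ ≤
          C * Skeleton.alpha1 D

/-- `StepB_mu2` in the reading of record `α₁ = α log T`: `Σ_l ϰ₂(l₁l)ϱ_j(l)/l = e_{2j} + O(α₁)`,
error `≤ C·alpha1 D`. CLAIM (implicit in print). [cite: Zhang2022LandauSiegel, App. B p.107] -/
def StepB_mu2R : Prop :=
  ∃ C : ℝ, Skeleton.ForAllLarge fun D _ _ =>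
    ∀ j ∈ ({1, 2, 3} : Finset ℕ), ∀ l₁ : ℕ, 1 ≤ l₁ → l₁ ∈ Skeleton.nset (Skeleton.frakq D) →
      (l₁ : ℝ) < Skeleton.bigT D →
        ‖vkSum c' D (Skeleton.vk2 D) j l₁ - e2j j‖ ≤ C * Skeleton.alpha1 D

/-- `StepB_mu3` in the reading of record `α₁ = α log T`: `Σ_l ϰ₃(l₁l)ϱ_j(l)/l = e_{3j} + O(α₁)`,
error `≤ C·alpha1 D`. CLAIM (implicit in print). [cite: Zhang2022LandauSiegel, App. B p.107] -/
def StepB_mu3R : Prop :=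
  ∃ C : ℝ, Skeleton.ForAllLarge fun D _ _ =>
    ∀ j ∈ ({1, 2, 3} : Finset ℕ), ∀ l₁ : ℕ, 1 ≤ l₁ → l₁ ∈ Skeleton.nset (Skeleton.frakq D) →
      (l₁ : ℝ) < Skeleton.bigT D →
        ‖vkSum c' D (Skeleton.vk3 D) j l₁ - e3j j‖ ≤ C * Skeleton.alpha1 D

/-- `StepB_u012` in the reading of record `α₁ = α log T`: `Σ_l ϰ₁(l₁l)ϱ_j(l)/l = e′_{1j} + O(α₁)`,
error `≤ C·alpha1 D`. CLAIM. [cite: Zhang2022LandauSiegel, App. B p.107] -/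
def StepB_u012R : Prop :=
  ∃ C : ℝ, Skeleton.ForAllLarge fun D _ _ =>
    ∀ j ∈ ({1, 2, 3} : Finset ℕ), ∀ l₁ : ℕ, 1 ≤ l₁ → l₁ ∈ Skeleton.nset (Skeleton.frakq D) →
      (l₁ : ℝ) < Skeleton.bigT D →
        ‖vkSum c' D (Skeleton.vk1 D) j l₁ - e1pj j‖ ≤ C * Skeleton.alpha1 D

/-- **(B.3)** in the reading of record `α₁ = α log T` (tail `= e″_{1j} + O(α₁)` with the STATED `e″_{1j}`,
error `≤ C·alpha1 D`). CLAIM. [cite: Zhang2022LandauSiegel, App. B (B.3), p.108] -/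
def EqB_3R : Prop :=
  ∃ C : ℝ, Skeleton.ForAllLarge fun D _ _ =>
    ∀ j ∈ ({1, 2, 3} : Finset ℕ), ∀ l₁ : ℕ, 1 ≤ l₁ → l₁ ∈ Skeleton.nset (Skeleton.frakq D) →
      (l₁ : ℝ) < Skeleton.bigT D →
        ‖tailB3 c' D j l₁ - e1ppj j‖ ≤ C * Skeleton.alpha1 D

/-- `StepB_u013` in the reading of record `α₁ = α log T` (error `≤ C·alpha1 D`). CLAIM.
[cite: Zhang2022LandauSiegel, App. B p.108] -/
def StepB_u013R : Prop :=
  ∃ C : ℝ, Skeleton.ForAllLarge fun D _ _ =>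
    ∀ j ∈ ({1, 2, 3} : Finset ℕ), ∀ l₁ : ℕ, 1 ≤ l₁ → l₁ ∈ Skeleton.nset (Skeleton.frakq D) →
      (l₁ : ℝ) < Skeleton.bigT D →
        ‖tailB3 c' D j l₁ - seriesB13 c' D j l₁‖ ≤ C * Skeleton.alpha1 D

/-- `StepB_u015a` in the reading of record `α₁ = α log T` (the bare "`+O`" of tex L5331 read `O(α₁)`,
error `≤ C·alpha1 D`). CLAIM. [cite: Zhang2022LandauSiegel, App. B p.108] -/
def StepB_u015aR : Prop :=
  ∃ C : ℝ, Skeleton.ForAllLarge fun D _ _ =>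
    ∀ j ∈ ({1, 2, 3} : Finset ℕ), ∀ l₁ : ℕ, 1 ≤ l₁ → l₁ ∈ Skeleton.nset (Skeleton.frakq D) →
      (l₁ : ℝ) < Skeleton.bigT D →
        ‖tailB3 c' D j l₁ - doubleB15 c' D j l₁‖ ≤ C * Skeleton.alpha1 D

/-- `StepB_u015b` in the reading of record `α₁ = α log T` (error `≤ C·alpha1 D`). CLAIM.
[cite: Zhang2022LandauSiegel, App. B p.108] -/
def StepB_u015bR : Prop :=
  ∃ C : ℝ, Skeleton.ForAllLarge fun D _ _ =>
    ∀ j ∈ ({1, 2, 3} : Finset ℕ), ∀ l₁ : ℕ, 1 ≤ l₁ → l₁ ∈ Skeleton.nset (Skeleton.frakq D) →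
      (l₁ : ℝ) < Skeleton.bigT D →
        ‖doubleB15 c' D j l₁ - valueB15 c' D j‖ ≤ C * Skeleton.alpha1 D

/-- `StepB_u015c` (the closing "□" of the proof of (B.3)) in the reading of record `α₁ = α log T`
(error `≤ C·alpha1 D`). CLAIM (implicit in print). NOTE: the kernel refutation of the banked form
(`Numerics.not_StepB_u015c`, file `NumericsSection15AppB`: at `j = 1` the two sides differ by a constant
`> 3.8·10⁻⁵` while `α𝓛 → 0`) applies verbatim to this form, since `α₁ → 0` as well; typed for
completeness of the re-reading, not endorsed. [cite: Zhang2022LandauSiegel, App. B p.108] -/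
def StepB_u015cR : Prop :=
  ∃ C : ℝ, Skeleton.ForAllLarge fun D _ _ =>
    ∀ j ∈ ({1, 2, 3} : Finset ℕ),
      ‖valueB15 c' D j - e1ppj j‖ ≤ C * Skeleton.alpha1 D

/-! ### Comparison edges: each banked `α𝓛` form implies its `α₁` form -/

/-- `x ≤ C·α·𝓛 ⇒ x ≤ max(C,0)·α₁` for `D ≥ 3` (`α𝓛 ≤ α₁`, `Skeleton.alpha_mul_ell_le_alpha1`). [folklore] -/
private theorem le_alpha1_of_le {D : ℕ} (hD : 3 ≤ D) {x C : ℝ}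
    (h : x ≤ C * Skeleton.alpha D * Skeleton.ell D) : x ≤ max C 0 * Skeleton.alpha1 D := by
  have hαℓ : 0 ≤ Skeleton.alpha D * Skeleton.ell D :=
    mul_nonneg (Skeleton.alpha_pos hD).le (by linarith [Skeleton.one_lt_ell hD])
  calc x ≤ C * Skeleton.alpha D * Skeleton.ell D := h
    _ = C * (Skeleton.alpha D * Skeleton.ell D) := by ring
    _ ≤ max C 0 * (Skeleton.alpha D * Skeleton.ell D) :=
        mul_le_mul_of_nonneg_right (le_max_left _ _) hαℓ
    _ ≤ max C 0 * Skeleton.alpha1 D :=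
        mul_le_mul_of_nonneg_left (Skeleton.alpha_mul_ell_le_alpha1 hD) (le_max_right _ _)

/-- The banked `α𝓛` form implies the `α₁` form. [cite: Zhang2022LandauSiegel, App. B p.107] -/
theorem stepB_u009rR_of (h : StepB_u009r c') : StepB_u009rR c' := by
  obtain ⟨C, D₀, h⟩ := h
  refine ⟨max C 0, max D₀ 3, fun D _ χ hD hq hp => ?_⟩
  have hD3 : 3 ≤ D := le_trans (le_max_right _ _) hD
  have h := h D χ (le_trans (le_max_left _ _) hD) hq hp
  dsimp only at h ⊢
  intro j hj l₁ h1 h2 h3; exact le_alpha1_of_le hD3 (h j hj l₁ h1 h2 h3)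

/-- The banked `α𝓛` form implies the `α₁` form. [cite: Zhang2022LandauSiegel, App. B p.107] -/
theorem stepB_u010bR_of (h : StepB_u010b c') : StepB_u010bR c' := by
  obtain ⟨C, D₀, h⟩ := h
  refine ⟨max C 0, max D₀ 3, fun D _ χ hD hq hp => ?_⟩
  have hD3 : 3 ≤ D := le_trans (le_max_right _ _) hD
  have h := h D χ (le_trans (le_max_left _ _) hD) hq hp
  dsimp only at h ⊢
  intro j hj; exact le_alpha1_of_le hD3 (h j hj)

/-- The banked `α𝓛` form implies the `α₁` form. [cite: Zhang2022LandauSiegel, App. B p.107] -/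
theorem stepB_u011bR_of (h : StepB_u011b c') : StepB_u011bR c' := by
  obtain ⟨C, D₀, h⟩ := h
  refine ⟨max C 0, max D₀ 3, fun D _ χ hD hq hp => ?_⟩
  have hD3 : 3 ≤ D := le_trans (le_max_right _ _) hD
  have h := h D χ (le_trans (le_max_left _ _) hD) hq hp
  dsimp only at h ⊢
  intro j hj l₁ h1 h2 h3; exact le_alpha1_of_le hD3 (h j hj l₁ h1 h2 h3)

/-- The banked `α𝓛` form implies the `α₁` form. [cite: Zhang2022LandauSiegel, App. B p.107] -/
theorem stepB_mu2R_of (h : StepB_mu2 c') : StepB_mu2R c' := by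
  obtain ⟨C, D₀, h⟩ := h
  refine ⟨max C 0, max D₀ 3, fun D _ χ hD hq hp => ?_⟩
  have hD3 : 3 ≤ D := le_trans (le_max_right _ _) hD
  have h := h D χ (le_trans (le_max_left _ _) hD) hq hp
  dsimp only at h ⊢
  intro j hj l₁ h1 h2 h3; exact le_alpha1_of_le hD3 (h j hj l₁ h1 h2 h3)

/-- The banked `α𝓛` form implies the `α₁` form. [cite: Zhang2022LandauSiegel, App. B p.107] -/
theorem stepB_mu3R_of (h : StepB_mu3 c') : StepB_mu3R c' := by
  obtain ⟨C, D₀, h⟩ := h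
  refine ⟨max C 0, max D₀ 3, fun D _ χ hD hq hp => ?_⟩
  have hD3 : 3 ≤ D := le_trans (le_max_right _ _) hD
  have h := h D χ (le_trans (le_max_left _ _) hD) hq hp
  dsimp only at h ⊢
  intro j hj l₁ h1 h2 h3; exact le_alpha1_of_le hD3 (h j hj l₁ h1 h2 h3)

/-- The banked `α𝓛` form implies the `α₁` form. [cite: Zhang2022LandauSiegel, App. B p.107] -/
theorem stepB_u012R_of (h : StepB_u012 c') : StepB_u012R c' := by
  obtain ⟨C, D₀, h⟩ := h
  refine ⟨max C 0, max D₀ 3, fun D _ χ hD hq hp => ?_⟩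
  have hD3 : 3 ≤ D := le_trans (le_max_right _ _) hD
  have h := h D χ (le_trans (le_max_left _ _) hD) hq hp
  dsimp only at h ⊢
  intro j hj l₁ h1 h2 h3; exact le_alpha1_of_le hD3 (h j hj l₁ h1 h2 h3)

/-- The banked `α𝓛` form implies the `α₁` form. [cite: Zhang2022LandauSiegel, App. B (B.3), p.108] -/
theorem eqB_3R_of (h : EqB_3 c') : EqB_3R c' := by
  obtain ⟨C, D₀, h⟩ := h
  refine ⟨max C 0, max D₀ 3, fun D _ χ hD hq hp => ?_⟩
  have hD3 : 3 ≤ D := le_trans (le_max_right _ _) hD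
  have h := h D χ (le_trans (le_max_left _ _) hD) hq hp
  dsimp only at h ⊢
  intro j hj l₁ h1 h2 h3; exact le_alpha1_of_le hD3 (h j hj l₁ h1 h2 h3)

/-- The banked `α𝓛` form implies the `α₁` form. [cite: Zhang2022LandauSiegel, App. B p.108] -/
theorem stepB_u013R_of (h : StepB_u013 c') : StepB_u013R c' := by
  obtain ⟨C, D₀, h⟩ := h
  refine ⟨max C 0, max D₀ 3, fun D _ χ hD hq hp => ?_⟩
  have hD3 : 3 ≤ D := le_trans (le_max_right _ _) hD
  have h := h D χ (le_trans (le_max_left _ _) hD) hq hp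
  dsimp only at h ⊢
  intro j hj l₁ h1 h2 h3; exact le_alpha1_of_le hD3 (h j hj l₁ h1 h2 h3)

/-- The banked `α𝓛` form implies the `α₁` form. [cite: Zhang2022LandauSiegel, App. B p.108] -/
theorem stepB_u015aR_of (h : StepB_u015a c') : StepB_u015aR c' := by
  obtain ⟨C, D₀, h⟩ := h
  refine ⟨max C 0, max D₀ 3, fun D _ χ hD hq hp => ?_⟩
  have hD3 : 3 ≤ D := le_trans (le_max_right _ _) hD
  have h := h D χ (le_trans (le_max_left _ _) hD) hq hp
  dsimp only at h ⊢
  intro j hj l₁ h1 h2 h3; exact le_alpha1_of_le hD3 (h j hj l₁ h1 h2 h3)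

/-- The banked `α𝓛` form implies the `α₁` form. [cite: Zhang2022LandauSiegel, App. B p.108] -/
theorem stepB_u015bR_of (h : StepB_u015b c') : StepB_u015bR c' := by
  obtain ⟨C, D₀, h⟩ := h
  refine ⟨max C 0, max D₀ 3, fun D _ χ hD hq hp => ?_⟩
  have hD3 : 3 ≤ D := le_trans (le_max_right _ _) hD
  have h := h D χ (le_trans (le_max_left _ _) hD) hq hp
  dsimp only at h ⊢
  intro j hj l₁ h1 h2 h3; exact le_alpha1_of_le hD3 (h j hj l₁ h1 h2 h3)

/-- The banked `α𝓛` form implies the `α₁` form. [cite: Zhang2022LandauSiegel, App. B p.108] -/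
theorem stepB_u015cR_of (h : StepB_u015c c') : StepB_u015cR c' := by
  obtain ⟨C, D₀, h⟩ := h
  refine ⟨max C 0, max D₀ 3, fun D _ χ hD hq hp => ?_⟩
  have hD3 : 3 ≤ D := le_trans (le_max_right _ _) hD
  have h := h D χ (le_trans (le_max_left _ _) hD) hq hp
  dsimp only at h ⊢
  intro j hj; exact le_alpha1_of_le hD3 (h j hj)

/-! ### `Z22:§B.u010`, second equality: the exact `D`-dependence, the reading of record PROVED,
the banked reading REFUTED -/

/-- `log P₂ = 0.5𝓛⁹ − 10𝓛^{1.1}` ((2.21) `P₂ = P^{1/2}T^{−10}`, `log P = 𝓛⁹`, `log T = 𝓛^{1.1}`). [folklore] -/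
private theorem log_P2_eq (D : ℕ) :
    Real.log (Skeleton.P2 D) = 0.5 * Skeleton.ell D ^ 9 - 10 * Skeleton.ell D ^ (1.1 : ℝ) := by
  have hP : 0 < Skeleton.bigP D := Real.exp_pos _
  have hT : 0 < Skeleton.bigT D := Real.exp_pos _
  rw [Skeleton.P2, Real.log_div (Real.rpow_pos_of_pos hP _).ne' (pow_pos hT _).ne',
    Real.log_rpow hP, Real.log_pow, Skeleton.log_bigP, Skeleton.log_bigT]
  push_cast; ring

/-- `β_j = i·jα·(1 + κ_j c′α𝓛)` with `|κ_j| ≤ 5` (`κ₁ = −5`, `κ₂ = 1`, `κ₃ = −1`: (2.13) with the index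
convention of §8). [cite: Zhang2022LandauSiegel, §2 (2.13)] -/
theorem betaJ_eq_of_mem (c' : ℝ) (D : ℕ) {j : ℕ} (hj : j ∈ ({1, 2, 3} : Finset ℕ)) :
    ∃ κ : ℝ, |κ| ≤ 5 ∧ Skeleton.betaJ c' D j =
      I * ((j * Skeleton.alpha D * (1 + κ * c' * Skeleton.alpha D * Skeleton.ell D) : ℝ) : ℂ) := by
  simp only [Finset.mem_insert, Finset.mem_singleton] at hj
  rcases hj with rfl | rfl | rfl
  · refine ⟨-5, by norm_num, ?_⟩
    simp only [Skeleton.betaJ, Skeleton.beta1, Nat.one_mod, if_true]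
    push_cast; ring
  · refine ⟨1, by norm_num, ?_⟩
    simp only [Skeleton.betaJ, Skeleton.beta2, show ¬ (2 % 3 = 1) by decide, show (2 % 3 = 2) by decide,
      if_false, if_true]
    push_cast; ring
  · refine ⟨-1, by norm_num, ?_⟩
    simp only [Skeleton.betaJ, Skeleton.beta3, show ¬ (3 % 3 = 1) by decide, show ¬ (3 % 3 = 2) by decide,
      if_false]
    push_cast; ring

/-- **Exact `D`-dependence of the left side of `Z22:§B.u010` (second equality).** For `D ≥ 3` and
`j ∈ {1,2,3}`, with `δ = (20/π)·α·𝓛^{1.1}` (`= 20𝓛^{−7.9}`, as `α𝓛⁹ = π`) and `1 − δ ≠ 0`: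
`−β_j/(β₇² log P₂) − (−8j/(25πi)) = i·(8j/25π)·(κ_j c′α𝓛 + δ)/(1 − δ)`
(`β₇² = −25α²/4`, `log P₂ = (π/2α)(1 − δ)`). The `δ`-term is `≍ α𝓛^{1.1} = α₁`, NOT `O(α𝓛)`.
[cite: Zhang2022LandauSiegel, App. B p.107] -/
theorem resZero2_sub_main_eq (c' : ℝ) {D : ℕ} (hD : 3 ≤ D) {j : ℕ} (hj : j ∈ ({1, 2, 3} : Finset ℕ))
    (hδ : 1 - 20 / π * Skeleton.alpha D * Skeleton.ell D ^ (1.1 : ℝ) ≠ 0) :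
    ∃ κ : ℝ, |κ| ≤ 5 ∧
      resZero2 c' D j - (-(8 * (j : ℂ) / (25 * π * I))) =
        I * ((8 * j / (25 * π) *
          ((κ * c' * Skeleton.alpha D * Skeleton.ell D + 20 / π * Skeleton.alpha D * Skeleton.ell D ^ (1.1 : ℝ)) /
            (1 - 20 / π * Skeleton.alpha D * Skeleton.ell D ^ (1.1 : ℝ))) : ℝ) : ℂ) := by
  obtain ⟨κ, hκ, hβ⟩ := betaJ_eq_of_mem c' D hj
  refine ⟨κ, hκ, ?_⟩
  have hα : 0 < Skeleton.alpha D := Skeleton.alpha_pos hD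
  have hπ : (π : ℝ) ≠ 0 := Real.pi_ne_zero
  have h9 : Skeleton.ell D ^ 9 = π / Skeleton.alpha D := by
    have h9' : 0 < Skeleton.ell D ^ 9 := pow_pos (by linarith [Skeleton.one_lt_ell hD]) 9
    rw [Skeleton.alpha, Skeleton.log_bigP]
    field_simp
  have hP2 := log_P2_eq D
  generalize hL : Skeleton.ell D ^ (1.1 : ℝ) = Lr at hP2 hδ ⊢
  have hP2' : Real.log (Skeleton.P2 D) =
      π / (2 * Skeleton.alpha D) * (1 - 20 / π * Skeleton.alpha D * Lr) := by
    rw [hP2, h9]; field_simp; ring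
  have hT : -(8 * (j : ℂ) / (25 * π * I)) = I * ((8 * j / (25 * π) : ℝ) : ℂ) := by
    rw [show (25 * (π : ℂ) * I) = (25 * π) * I by ring, ← div_div, Complex.div_I]
    push_cast; ring
  have h7 : Skeleton.beta7 D ^ 2 = -((25 / 4 * Skeleton.alpha D ^ 2 : ℝ) : ℂ) := by
    rw [Skeleton.beta7]
    have : (5 * I * (Skeleton.alpha D : ℂ) / 2) ^ 2 = 25 / 4 * (Skeleton.alpha D : ℂ) ^ 2 * I ^ 2 := by
      ring
    rw [this, Complex.I_sq]; push_cast; ring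
  -- the real identity behind the display
  have hre : -(j * Skeleton.alpha D * (1 + κ * c' * Skeleton.alpha D * Skeleton.ell D)) /
        (-(25 / 4 * Skeleton.alpha D ^ 2) * (π / (2 * Skeleton.alpha D) * (1 - 20 / π * Skeleton.alpha D * Lr))) -
        8 * j / (25 * π) =
      8 * j / (25 * π) * ((κ * c' * Skeleton.alpha D * Skeleton.ell D + 20 / π * Skeleton.alpha D * Lr) /
        (1 - 20 / π * Skeleton.alpha D * Lr)) := by
    rw [sub_eq_iff_eq_add, div_eq_iff (by
      apply mul_ne_zero
      · simp [hα.ne']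
      · exact mul_ne_zero (by positivity) hδ)]
    rw [mul_div_assoc', div_add' _ _ _ hδ, div_mul_eq_mul_div, eq_div_iff hδ]
    field_simp
    ring
  rw [hT, resZero2, hβ, h7, hP2']
  calc -(I * ((j * Skeleton.alpha D * (1 + κ * c' * Skeleton.alpha D * Skeleton.ell D) : ℝ) : ℂ)) /
        (-((25 / 4 * Skeleton.alpha D ^ 2 : ℝ) : ℂ) *
          ((π / (2 * Skeleton.alpha D) * (1 - 20 / π * Skeleton.alpha D * Lr) : ℝ) : ℂ)) -
        I * ((8 * j / (25 * π) : ℝ) : ℂ)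
      = I * ((-(j * Skeleton.alpha D * (1 + κ * c' * Skeleton.alpha D * Skeleton.ell D)) /
          (-(25 / 4 * Skeleton.alpha D ^ 2) * (π / (2 * Skeleton.alpha D) * (1 - 20 / π * Skeleton.alpha D * Lr))) -
          8 * j / (25 * π) : ℝ) : ℂ) := by
        push_cast; ring
    _ = _ := by rw [hre]

/-- `𝓛 ≥ 2` for `D ≥ 8` (`e² < 8`). [folklore] -/
private theorem two_le_ell' {D : ℕ} (hD : 8 ≤ D) : 2 ≤ Skeleton.ell D := by
  have h8 : (8 : ℝ) ≤ D := by exact_mod_cast hD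
  have he : Real.exp 2 ≤ 8 := by
    have h1 := Real.exp_one_lt_d9
    have : Real.exp 2 = Real.exp 1 * Real.exp 1 := by rw [← Real.exp_add]; norm_num
    rw [this]; nlinarith [Real.exp_pos 1]
  calc (2 : ℝ) = Real.log (Real.exp 2) := (Real.log_exp 2).symm
    _ ≤ Real.log 8 := Real.log_le_log (Real.exp_pos 2) he
    _ ≤ Skeleton.ell D := Real.log_le_log (by norm_num) h8

/-- `δ = (20/π)α𝓛^{1.1} ≤ 1/2` for `D ≥ 8` (`α𝓛^{1.1} ≤ α𝓛² = π/𝓛⁷ ≤ π/128`). [folklore] -/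
private theorem delta_le_half {D : ℕ} (hD : 8 ≤ D) :
    0 ≤ 20 / π * Skeleton.alpha D * Skeleton.ell D ^ (1.1 : ℝ) ∧
      20 / π * Skeleton.alpha D * Skeleton.ell D ^ (1.1 : ℝ) ≤ 1 / 2 := by
  have hD3 : 3 ≤ D := le_trans (by norm_num) hD
  have hα : 0 < Skeleton.alpha D := Skeleton.alpha_pos hD3
  have hℓ2 : 2 ≤ Skeleton.ell D := two_le_ell' hD
  have hℓ1 : 1 ≤ Skeleton.ell D := by linarith
  have h9 : Skeleton.alpha D * Skeleton.ell D ^ 9 = π := by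
    have h9' : 0 < Skeleton.ell D ^ 9 := pow_pos (by linarith) 9
    rw [Skeleton.alpha, Skeleton.log_bigP]; field_simp
  have hL2 : Skeleton.ell D ^ (1.1 : ℝ) ≤ Skeleton.ell D ^ 2 := by
    calc Skeleton.ell D ^ (1.1 : ℝ) ≤ Skeleton.ell D ^ (2 : ℝ) :=
          Real.rpow_le_rpow_of_exponent_le hℓ1 (by norm_num)
      _ = Skeleton.ell D ^ 2 := Real.rpow_two _
  have h128 : (128 : ℝ) ≤ Skeleton.ell D ^ 7 := by
    calc (128 : ℝ) = 2 ^ 7 := by norm_num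
      _ ≤ Skeleton.ell D ^ 7 := pow_le_pow_left₀ (by norm_num) hℓ2 7
  refine ⟨mul_nonneg (mul_nonneg (by positivity) hα.le) (Real.rpow_nonneg (by linarith) _), ?_⟩
  -- `α𝓛² · 𝓛⁷ = π`, so `α𝓛^{1.1} ≤ α𝓛² = π/𝓛⁷ ≤ π/128`
  have hαℓ2 : Skeleton.alpha D * Skeleton.ell D ^ 2 = π / Skeleton.ell D ^ 7 := by
    rw [eq_div_iff (by positivity)]; rw [← h9]; ring
  have h1 : Skeleton.alpha D * Skeleton.ell D ^ (1.1 : ℝ) ≤ π / Skeleton.ell D ^ 7 := by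
    rw [← hαℓ2]; exact mul_le_mul_of_nonneg_left hL2 hα.le
  have h2 : π / Skeleton.ell D ^ 7 ≤ π / 128 := div_le_div_of_nonneg_left Real.pi_pos.le (by norm_num) h128
  calc 20 / π * Skeleton.alpha D * Skeleton.ell D ^ (1.1 : ℝ)
      = 20 / π * (Skeleton.alpha D * Skeleton.ell D ^ (1.1 : ℝ)) := by ring
    _ ≤ 20 / π * (π / 128) := mul_le_mul_of_nonneg_left (h1.trans h2) (by positivity)
    _ = 20 / 128 := by field_simp
    _ ≤ 1 / 2 := by norm_num

/-- **`Z22:§B.u010` (second equality) HOLDS in the reading of record `α₁ = α log T`**: for `D ≥ 8` and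
`j ∈ {1,2,3}`, `‖−β_j/(β₇² log P₂) − (−8j/(25πi))‖ ≤ C·α₁` with `C = (48/25π)(5|c′| + 20/π)`
(from `resZero2_sub_main_eq`: `|κ_j c′|α𝓛 ≤ 5|c′|α₁`, `δ = (20/π)α₁ ≤ 1/2`). DISCHARGED (`α₁`-form of a
node typed false under the bank's earlier reading). [cite: Zhang2022LandauSiegel, App. B p.107] -/
theorem stepB_u010bR_holds : StepB_u010bR c' := by
  refine ⟨48 / (25 * π) * (5 * |c'| + 20 / π), 8, fun D _ χ hD _ _ => ?_⟩
  dsimp only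
  intro j hj
  have hD3 : 3 ≤ D := le_trans (by norm_num) hD
  have hα : 0 < Skeleton.alpha D := Skeleton.alpha_pos hD3
  have hℓ1 : 1 ≤ Skeleton.ell D := (Skeleton.one_lt_ell hD3).le
  have hℓ : 0 < Skeleton.ell D := by linarith
  obtain ⟨hδ0, hδ⟩ := delta_le_half hD
  have hδne : 1 - 20 / π * Skeleton.alpha D * Skeleton.ell D ^ (1.1 : ℝ) ≠ 0 := by linarith
  obtain ⟨κ, hκ, hEq⟩ := resZero2_sub_main_eq c' hD3 hj hδne
  have hj3 : (j : ℝ) ≤ 3 := by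
    simp only [Finset.mem_insert, Finset.mem_singleton] at hj
    rcases hj with rfl | rfl | rfl <;> norm_num
  rw [hEq, norm_mul, Complex.norm_I, one_mul, Complex.norm_real, Real.norm_eq_abs, Skeleton.alpha1,
    Skeleton.log_bigT]
  have hLℓ : Skeleton.ell D ≤ Skeleton.ell D ^ (1.1 : ℝ) := by
    calc Skeleton.ell D = Skeleton.ell D ^ (1 : ℝ) := (Real.rpow_one _).symm
      _ ≤ Skeleton.ell D ^ (1.1 : ℝ) := Real.rpow_le_rpow_of_exponent_le hℓ1 (by norm_num)
  generalize hL : Skeleton.ell D ^ (1.1 : ℝ) = Lr at hδ0 hδ hδne hLℓ ⊢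
  have hL0 : 0 < Lr := lt_of_lt_of_le hℓ hLℓ
  have h1δ : 0 < 1 - 20 / π * Skeleton.alpha D * Lr := by linarith
  have hnum : |κ * c' * Skeleton.alpha D * Skeleton.ell D + 20 / π * Skeleton.alpha D * Lr| ≤
      (5 * |c'| + 20 / π) * (Skeleton.alpha D * Lr) := by
    have e1 : |κ * c' * Skeleton.alpha D * Skeleton.ell D| ≤ 5 * |c'| * (Skeleton.alpha D * Lr) := by
      rw [abs_mul, abs_mul, abs_mul, abs_of_pos hα, abs_of_pos hℓ]
      have := mul_le_mul hκ (mul_le_mul_of_nonneg_left (mul_le_mul_of_nonneg_left hLℓ hα.le)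
        (abs_nonneg c')) (by positivity) (by norm_num : (0 : ℝ) ≤ 5)
      calc |κ| * |c'| * Skeleton.alpha D * Skeleton.ell D
          = |κ| * (|c'| * (Skeleton.alpha D * Skeleton.ell D)) := by ring
        _ ≤ 5 * (|c'| * (Skeleton.alpha D * Lr)) := this
        _ = 5 * |c'| * (Skeleton.alpha D * Lr) := by ring
    calc |κ * c' * Skeleton.alpha D * Skeleton.ell D + 20 / π * Skeleton.alpha D * Lr|
        ≤ |κ * c' * Skeleton.alpha D * Skeleton.ell D| + |20 / π * Skeleton.alpha D * Lr| :=
          abs_add_le _ _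
      _ ≤ 5 * |c'| * (Skeleton.alpha D * Lr) + 20 / π * (Skeleton.alpha D * Lr) := by
          have h20 : 0 ≤ 20 / π * (Skeleton.alpha D * Lr) :=
            mul_nonneg (div_nonneg (by norm_num) Real.pi_pos.le) (mul_pos hα hL0).le
          rw [show 20 / π * Skeleton.alpha D * Lr = 20 / π * (Skeleton.alpha D * Lr) by ring,
            abs_of_nonneg h20]
          linarith [e1]
      _ = (5 * |c'| + 20 / π) * (Skeleton.alpha D * Lr) := by ring
  have h825 : (0 : ℝ) ≤ 8 * j / (25 * π) := by positivity
  rw [abs_mul, abs_of_nonneg h825,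
    abs_div (κ * c' * Skeleton.alpha D * Skeleton.ell D + 20 / π * Skeleton.alpha D * Lr)
      (1 - 20 / π * Skeleton.alpha D * Lr), abs_of_pos h1δ]
  have hK : 0 ≤ (5 * |c'| + 20 / π) * (Skeleton.alpha D * Lr) :=
    mul_nonneg (by positivity) (mul_pos hα hL0).le
  have hfrac : |κ * c' * Skeleton.alpha D * Skeleton.ell D + 20 / π * Skeleton.alpha D * Lr| /
      (1 - 20 / π * Skeleton.alpha D * Lr) ≤ 2 * ((5 * |c'| + 20 / π) * (Skeleton.alpha D * Lr)) := by
    rw [div_le_iff₀ h1δ]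
    nlinarith [hnum, hK, hδ, mul_nonneg hK (by linarith : (0 : ℝ) ≤ 1 / 2 - 20 / π * Skeleton.alpha D * Lr)]
  have h8 : 8 * (j : ℝ) / (25 * π) ≤ 24 / (25 * π) := by
    rw [div_le_div_iff_of_pos_right (by positivity)]; linarith
  calc 8 * (j : ℝ) / (25 * π) *
        (|κ * c' * Skeleton.alpha D * Skeleton.ell D + 20 / π * Skeleton.alpha D * Lr| /
          (1 - 20 / π * Skeleton.alpha D * Lr))
      ≤ 24 / (25 * π) * (2 * ((5 * |c'| + 20 / π) * (Skeleton.alpha D * Lr))) :=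
        mul_le_mul h8 hfrac (div_nonneg (abs_nonneg _) h1δ.le) (by positivity)
    _ = 48 / (25 * π) * (5 * |c'| + 20 / π) * (Skeleton.alpha D * Lr) := by ring

/-- `StepB_u010bR` — `_holds` alias of `stepB_u010bR_holds` above under the fact's exact name (appended
2026-08-28, D-0026 bookkeeping: the proof term is the existing theorem of this file; no statement,
definition or attribute is edited; no new named fact; the ledger's debt table listed the fact
unproved). [cite: Zhang2022LandauSiegel, App. B p.107] -/
theorem _root_.Literature.NumberTheory.LFunctions.Zhang2022.Typed.AppendixB.StepB_u010bR_holds :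
    StepB_u010bR c' :=
  _root_.Literature.NumberTheory.LFunctions.Zhang2022.Typed.AppendixB.stepB_u010bR_holds (c' := c')

/-! ### Testing at large prime moduli: the banked `α𝓛` form of `Z22:§B.u010` is refuted -/

-- The next three declarations are private copies of `NumericsSection15AppB`'s Legendre-character test
-- (that file imports this one, so they cannot be imported here).
/-- `(·/p) ⊗ ℂ` is a quadratic Dirichlet character mod `p`. [folklore] -/
private theorem isQuadratic_legendre' (p : ℕ) [Fact p.Prime] :
    ((quadraticChar (ZMod p)).ringHomComp (Int.castRingHom ℂ)).IsQuadratic :=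
  (quadraticChar_isQuadratic (ZMod p)).comp _

/-- `(·/p) ⊗ ℂ` is primitive for an odd prime `p` (non-trivial, prime level). [folklore] -/
private theorem isPrimitive_legendre' (p : ℕ) [Fact p.Prime] (hp2 : p ≠ 2) :
    DirichletCharacter.IsPrimitive ((quadraticChar (ZMod p)).ringHomComp (Int.castRingHom ℂ)) := by
  rw [DirichletCharacter.isPrimitive_def]
  have hdvd := DirichletCharacter.conductor_dvd_level
    ((quadraticChar (ZMod p)).ringHomComp (Int.castRingHom ℂ))
  rcases (Nat.dvd_prime Fact.out).mp hdvd with h1 | h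
  · exfalso
    have hone := DirichletCharacter.eq_one_iff_conductor_eq_one.mpr h1
    have hF : ringChar (ZMod p) ≠ 2 := by rwa [ZMod.ringChar_zmod_n]
    obtain ⟨a, ha⟩ := quadraticChar_exists_neg_one hF
    have hau : IsUnit a := by
      by_contra hau
      rw [MulChar.map_nonunit _ hau] at ha
      norm_num at ha
    have h2 := congrArg (fun χ : DirichletCharacter ℂ p ↦ χ a) hone
    simp only [MulChar.ringHomComp_apply, ha] at h2
    rw [← hau.unit_spec, MulChar.one_apply_coe] at h2
    norm_num at h2
  · exact h

/-- A `ForAllLarge` statement can be tested at every large odd prime modulus with the Legendre character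
(§2 p. 4: "all real primitive `χ` to all large moduli"). [cite: Zhang2022LandauSiegel, §2 p. 4] -/
private theorem forAllLarge_at_large_prime' {S : (D : ℕ) → [NeZero D] → DirichletCharacter ℂ D → Prop}
    (h : Skeleton.ForAllLarge S) (N : ℕ) :
    ∃ p : ℕ, N ≤ p ∧ 3 ≤ p ∧ ∃ (_ : NeZero p) (χ : DirichletCharacter ℂ p), S p χ := by
  obtain ⟨D₀, hD₀⟩ := h
  obtain ⟨p, hp, hprime⟩ := Nat.exists_infinite_primes (max (max N 3) D₀)
  haveI : Fact p.Prime := ⟨hprime⟩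
  haveI : NeZero p := ⟨hprime.ne_zero⟩
  have hp2 : p ≠ 2 := by
    intro h2; subst h2
    have := (le_max_right N 3).trans ((le_max_left _ D₀).trans hp)
    omega
  refine ⟨p, (le_max_left N 3).trans ((le_max_left _ D₀).trans hp),
    (le_max_right N 3).trans ((le_max_left _ D₀).trans hp), inferInstance,
    (quadraticChar (ZMod p)).ringHomComp (Int.castRingHom ℂ), ?_⟩
  exact hD₀ p _ ((le_max_right _ D₀).trans hp) (isQuadratic_legendre' p) (isPrimitive_legendre' p hp2)

/-- **REFUTED under the bank's earlier reading `α₁ := α𝓛`: `¬ StepB_u010b c′` for every `c′`.** At a large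
prime modulus `p` (Legendre character), by `resZero2_sub_main_eq` at `j = 1`,
`‖−β₁/(β₇² log P₂) − (−8/(25πi))‖ ≥ (8/25π)·(δ − 5|c′|α𝓛)` with `δ = (20/π)α𝓛^{1.1} = (20/π)𝓛^{0.1}·α𝓛` and
`𝓛^{0.1} → ∞`, so no bound `C·α𝓛` holds. The display is TRUE in the reading of record
(`stepB_u010bR_holds`); row G-L4t10-2, closed by the ruling `α₁ := α log T`. Says nothing about Lemma 15.1's
role in the argument. [cite: Zhang2022LandauSiegel, App. B p.107] -/
theorem not_StepB_u010b : ¬ StepB_u010b c' := by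
  rintro ⟨C, hC⟩
  have hπ : (π : ℝ) ≠ 0 := Real.pi_ne_zero
  set M : ℝ := 25 * π * |C| / 8 + 5 * |c'| + 1 with hM
  set A : ℝ := π * M / 20 + 1 with hA
  have hM0 : 0 < M := by positivity
  have hA0 : 0 < A := by positivity
  obtain ⟨p, hpN, hp3, _inst, χ, hS⟩ := forAllLarge_at_large_prime' hC (max 8 ⌈Real.exp (A ^ 10)⌉₊)
  have hp8 : 8 ≤ p := le_trans (le_max_left _ _) hpN
  have hα : 0 < Skeleton.alpha p := Skeleton.alpha_pos hp3
  have hℓ : 0 < Skeleton.ell p := by linarith [Skeleton.one_lt_ell hp3]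
  have hαℓ : 0 < Skeleton.alpha p * Skeleton.ell p := mul_pos hα hℓ
  -- `𝓛 ≥ A¹⁰`, hence `𝓛^{0.1} ≥ A`
  have hℓA : A ^ 10 ≤ Skeleton.ell p := by
    have h1 : Real.exp (A ^ 10) ≤ p :=
      (Nat.le_ceil _).trans (by exact_mod_cast le_trans (le_max_right _ _) hpN)
    have := Real.log_le_log (Real.exp_pos _) h1
    rwa [Real.log_exp] at this
  have hℓ01 : A ≤ Skeleton.ell p ^ (0.1 : ℝ) := by
    have h := Real.rpow_le_rpow (by positivity : (0 : ℝ) ≤ A ^ 10) hℓA (by norm_num : (0 : ℝ) ≤ 0.1)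
    have hA' : (A ^ 10 : ℝ) ^ (0.1 : ℝ) = A := by
      rw [← Real.rpow_natCast, ← Real.rpow_mul hA0.le]; norm_num
    rwa [hA'] at h
  have hsplit : Skeleton.ell p ^ (1.1 : ℝ) = Skeleton.ell p * Skeleton.ell p ^ (0.1 : ℝ) := by
    rw [show (1.1 : ℝ) = 1 + 0.1 by norm_num, Real.rpow_add hℓ, Real.rpow_one]
  obtain ⟨hδ0, hδ⟩ := delta_le_half hp8
  have hδne : 1 - 20 / π * Skeleton.alpha p * Skeleton.ell p ^ (1.1 : ℝ) ≠ 0 := by linarith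
  have hj := hS 1 (by simp)
  obtain ⟨κ, hκ, hEq⟩ := resZero2_sub_main_eq c' hp3 (j := 1) (by simp) hδne
  rw [hEq, norm_mul, Complex.norm_I, one_mul, Complex.norm_real, Real.norm_eq_abs] at hj
  simp only [Nat.cast_one, mul_one] at hj
  generalize hL : Skeleton.ell p ^ (1.1 : ℝ) = Lr at hδ0 hδ hδne hj hsplit
  have h1δ : 0 < 1 - 20 / π * Skeleton.alpha p * Lr := by linarith
  -- the numerator is bounded below by `α𝓛·M − 5|c′|α𝓛`
  have e1 : 20 / π * (Skeleton.alpha p * Skeleton.ell p) * A ≤ 20 / π * Skeleton.alpha p * Lr := by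
    rw [hsplit]
    have := mul_le_mul_of_nonneg_left hℓ01 hαℓ.le
    calc 20 / π * (Skeleton.alpha p * Skeleton.ell p) * A
        = 20 / π * (Skeleton.alpha p * Skeleton.ell p * A) := by ring
      _ ≤ 20 / π * (Skeleton.alpha p * Skeleton.ell p * Skeleton.ell p ^ (0.1 : ℝ)) :=
          mul_le_mul_of_nonneg_left this (by positivity)
      _ = 20 / π * Skeleton.alpha p * (Skeleton.ell p * Skeleton.ell p ^ (0.1 : ℝ)) := by ring
  have e2 : -(5 * |c'| * (Skeleton.alpha p * Skeleton.ell p)) ≤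
      κ * c' * Skeleton.alpha p * Skeleton.ell p := by
    have h5 : |κ * c'| ≤ 5 * |c'| := by
      rw [abs_mul]; exact mul_le_mul_of_nonneg_right hκ (abs_nonneg _)
    have h3 : -(5 * |c'|) ≤ κ * c' := by linarith [neg_abs_le (κ * c')]
    calc -(5 * |c'| * (Skeleton.alpha p * Skeleton.ell p))
        = (-(5 * |c'|)) * (Skeleton.alpha p * Skeleton.ell p) := by ring
      _ ≤ (κ * c') * (Skeleton.alpha p * Skeleton.ell p) := mul_le_mul_of_nonneg_right h3 hαℓ.le
      _ = κ * c' * Skeleton.alpha p * Skeleton.ell p := by ring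
  have hA' : 20 / π * (Skeleton.alpha p * Skeleton.ell p) * A =
      Skeleton.alpha p * Skeleton.ell p * M + 20 / π * (Skeleton.alpha p * Skeleton.ell p) := by
    rw [hA]; field_simp
  have hlow : Skeleton.alpha p * Skeleton.ell p * M - 5 * |c'| * (Skeleton.alpha p * Skeleton.ell p) ≤
      κ * c' * Skeleton.alpha p * Skeleton.ell p + 20 / π * Skeleton.alpha p * Lr := by
    have h20 : 0 ≤ 20 / π * (Skeleton.alpha p * Skeleton.ell p) := by positivity
    linarith [e1, e2, hA']
  have hnum0 : 0 ≤ κ * c' * Skeleton.alpha p * Skeleton.ell p + 20 / π * Skeleton.alpha p * Lr := by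
    have : 5 * |c'| * (Skeleton.alpha p * Skeleton.ell p) ≤ Skeleton.alpha p * Skeleton.ell p * M := by
      rw [hM]
      nlinarith [hαℓ, mul_nonneg hαℓ.le (by positivity : (0 : ℝ) ≤ 25 * π * |C| / 8 + 1)]
    linarith [hlow]
  -- upper bound from the claim: `(8/25π)·num ≤ |C|·α𝓛`
  have hup : 8 / (25 * π) * (κ * c' * Skeleton.alpha p * Skeleton.ell p + 20 / π * Skeleton.alpha p * Lr) ≤
      |C| * (Skeleton.alpha p * Skeleton.ell p) := by
    have hge : κ * c' * Skeleton.alpha p * Skeleton.ell p + 20 / π * Skeleton.alpha p * Lr ≤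
        (κ * c' * Skeleton.alpha p * Skeleton.ell p + 20 / π * Skeleton.alpha p * Lr) /
          (1 - 20 / π * Skeleton.alpha p * Lr) := by
      rw [le_div_iff₀ h1δ]; nlinarith [hnum0, hδ0]
    calc 8 / (25 * π) * (κ * c' * Skeleton.alpha p * Skeleton.ell p + 20 / π * Skeleton.alpha p * Lr)
        ≤ 8 / (25 * π) * ((κ * c' * Skeleton.alpha p * Skeleton.ell p + 20 / π * Skeleton.alpha p * Lr) /
            (1 - 20 / π * Skeleton.alpha p * Lr)) := mul_le_mul_of_nonneg_left hge (by positivity)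
      _ ≤ |8 / (25 * π) * ((κ * c' * Skeleton.alpha p * Skeleton.ell p + 20 / π * Skeleton.alpha p * Lr) /
            (1 - 20 / π * Skeleton.alpha p * Lr))| := le_abs_self _
      _ ≤ C * Skeleton.alpha p * Skeleton.ell p := hj
      _ ≤ |C| * (Skeleton.alpha p * Skeleton.ell p) := by
          rw [mul_assoc]; exact mul_le_mul_of_nonneg_right (le_abs_self C) hαℓ.le
  -- lower bound: `(8/25π)·num ≥ |C|·α𝓛 + (8/25π)·α𝓛`
  have hM' : Skeleton.alpha p * Skeleton.ell p * M - 5 * |c'| * (Skeleton.alpha p * Skeleton.ell p) =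
      Skeleton.alpha p * Skeleton.ell p * (25 * π * |C| / 8 + 1) := by rw [hM]; ring
  have hdown : |C| * (Skeleton.alpha p * Skeleton.ell p) + 8 / (25 * π) * (Skeleton.alpha p * Skeleton.ell p) ≤
      8 / (25 * π) * (κ * c' * Skeleton.alpha p * Skeleton.ell p + 20 / π * Skeleton.alpha p * Lr) := by
    calc |C| * (Skeleton.alpha p * Skeleton.ell p) + 8 / (25 * π) * (Skeleton.alpha p * Skeleton.ell p)
        = 8 / (25 * π) * (Skeleton.alpha p * Skeleton.ell p * (25 * π * |C| / 8 + 1)) := by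
          field_simp
      _ ≤ 8 / (25 * π) * (κ * c' * Skeleton.alpha p * Skeleton.ell p + 20 / π * Skeleton.alpha p * Lr) :=
          mul_le_mul_of_nonneg_left (by rw [← hM']; exact hlow) (by positivity)
  have : 0 < 8 / (25 * π) * (Skeleton.alpha p * Skeleton.ell p) := by positivity
  linarith [hup, hdown]

end ReadingR

/-! ## `Z22:§B.u005` in the faithful two-constant reading (gap row G-d59-2) -/

section ReadingU005

variable (c' : ℝ)

/-- **`Z22:§B.u005`, two-constant reading** ("Thus the left side above is
`≤ (Σ_{q<D⁴}|ϱ_j(q)|/q)∏_{q<P}(1 + |ϱ_j(q)|/q + O(1/q²)) ≪ αΣ_{q<D⁴} log q/q`", p.107, tex L5275–5279):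
the node `StepB_u005 c′` verbatim except that the implied constant of the `O(1/q²)` inside the product
(`C₀`) and that of the final `≪` (`C`) are kept distinct, as printed (two independent implied
constants). Row G-d59-2: the single-constant typing `StepB_u005` is not provable (the shared `C`
inflates the product), while this form is proved by sz-d59 (`AppendixBVarrhoU005.stepB_u005_two`:
`C₀ = 28`, `C = 3(1+5|c′|π)e^{12π(1+5|c′|π)+28}`), whose file imports this one and bridges to it.
CLAIM (stated here, not asserted). DAG `Z22:§B.u005` [Z22 p.107, tex L5275].
[cite: Zhang2022LandauSiegel, App. B p.107] -/
def StepB_u005₂ : Prop :=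
  ∃ C₀ C : ℝ, Skeleton.ForAllLarge fun D _ _ =>
    ∀ j ∈ ({1, 2, 3} : Finset ℕ),
      (∑ n ∈ (Finset.Ico 1 ⌈Skeleton.bigP D⌉₊).filter (fun n => ¬ Nat.Coprime n (Skeleton.frakq D)),
            ‖varrhoJ c' D j n‖ / (n : ℝ) ≤
          (∑ q ∈ (Finset.range (D ^ 4)).filter Nat.Prime, ‖varrhoJ c' D j q‖ / q) *
            ∏ q ∈ (Finset.range ⌈Skeleton.bigP D⌉₊).filter Nat.Prime,
              (1 + ‖varrhoJ c' D j q‖ / q + C₀ / (q : ℝ) ^ 2)) ∧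
      ((∑ q ∈ (Finset.range (D ^ 4)).filter Nat.Prime, ‖varrhoJ c' D j q‖ / q) *
            ∏ q ∈ (Finset.range ⌈Skeleton.bigP D⌉₊).filter Nat.Prime,
              (1 + ‖varrhoJ c' D j q‖ / q + C₀ / (q : ℝ) ^ 2) ≤
          C * Skeleton.alpha D * ∑ q ∈ (Finset.range (D ^ 4)).filter Nat.Prime, Real.log q / q)

/-- The single-constant typing implies the two-constant reading (take `C₀ = C`).
[cite: Zhang2022LandauSiegel, App. B p.107] -/
theorem stepB_u005₂_of_u005 (h : StepB_u005 c') : StepB_u005₂ c' := by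
  obtain ⟨C, hC⟩ := h
  exact ⟨C, C, hC⟩

end ReadingU005

end Literature.NumberTheory.LFunctions.Zhang2022.Typed.AppendixB
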